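import Literature.NumberTheory.LFunctions.RealZeroGlobalLogDerivBound
import Literature.NumberTheory.LFunctions.ExplicitLandauPageFamily
import Literature.NumberTheory.LFunctions.LevinsonMontgomery
import Literature.NumberTheory.LFunctions.ZetaLogDerivSeries
import Literature.Analysis.SpecialFunctions.DigammaGauss
import Literature.Analysis.SpecialFunctions.DigammaVerticalSeries
import Literature.Analysis.SpecialFunctions.EulerMascheroniBounds
import Mathlib.Analysis.Complex.ExponentialBounds
import HarnessLib

/-!
# McCurley's explicit Landau theorem for two real characters (J. Number Theory 19 (1984), Thm. 2)
# — DISCHARGED via Stechkin's device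

Topic `Literature/NumberTheory/LFunctions` (namespace `Literature.NumberTheory.LFunctions`;
sub-namespaces `McCurleyStechkin` for the device and its constants, `DirichletTheta` for the
pair-Hadamard statements, as in `RealZeroGlobalLogDerivBound.lean`). Everything here is PROVED
(standard axioms); the three `def`s of `McCurleyStechkin` (`kappa = 1/√5`, `bigK = (1 − κ)/2`,
`sigmaOne σ = (1 + √(1+4σ²))/2`) and `prodChar`, `fdiff`, `fdiffZeta`, `eulerCorr` are
definitions with bodies; NO named fact is introduced. Final theorems:

* `McCurley1984_theorem2_holds : McCurley1984_theorem2` — the named fact of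
  `ExplicitLandauPageFamily.lean` (K. S. McCurley, *Explicit zero-free regions for Dirichlet
  L-functions*, J. Number Theory **19** (1984) 7–32, **Theorem 2**, p. 9: "Let `χ₁` and `χ₂` be
  distinct real primitive characters modulo `k₁` and `k₂`, respectively, and let `βᵢ` be a real
  zero of `L(s, χᵢ)`, `i = 1, 2`. Let `M₁ = max{k₁k₂/17, 13}` and let `R₁ = (5 − √5)/(15 − 10√2)`.
  Then `min{β₁, β₂} < 1 − 1/(R₁ log M₁)`.") is now a THEOREM of the tree; with it
  `thornerZaman2024_lemma24` (`thornerZaman2024_lemma24_of_mccurley2`) and the Corollary 2.5 /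
  Theorem 2.6 derivations of `ExplicitLandauPageFamilyProofs.lean` rest on proved statements only
  (besides Platt 2016 and the RH verifications they name).
* `thornerZaman2024_lemma24_holds : thornerZaman2024_lemma24` — the named fact of
  `ExplicitLandauPageFamily.lean` (J. Thorner, A. Zaman, Forum Math. **36** (2024), **Lemma 2.4**:
  distinct real primitive `χ (mod q)`, `χ' (mod q')`, `min{q,q'} > 400 000`, real zeros `β, β'` ⇒
  `min{β,β'} < 1 − (15 − 10√2)/((5 − √5) log(q'q/17))`) DISCHARGED: McCurley's Theorem 2 through the
  tree's derivation `thornerZaman2024_lemma24_of_mccurley2` (`q'q/17 > 13` there).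

## The printed proof and what is proved here

McCurley's §3 (pp. 21–22): with `f(σ,χ) = −Re[L'/L(σ,χ) − L'/L(σ₁,χ)/√5]`,
`σ₁ = (1+√(1+4σ²))/2` (§2 p. 10), the positivity
`−Σ_n Λ(n) n^{−σ}(1 − n^{σ−σ₁}/√5)(1+χ₁(n))(1+χ₂(n)) ≤ 0` (23), Lemma 3
(`f(σ,χ₀) < 1/(σ−1) − 0.7833`, (24)), Lemma 4 (Stechkin), Lemma 9 (imprimitive `χ₁χ₂`) and
Lemma 10 (real `χ`, the real zeros kept) give
`1/(σ−β₁) + 1/(σ−β₂) − 1/(σ−1) < 2K log k₁k₂ − 1.59 < 2K log(k₁k₂/17)` (25), `K = (5−√5)/10`;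
then `σ = 1 + r/log M₁`, `min β = 1 − b/log M₁` give `b > 2r/(1+2Kr) − r` (26), maximal at
`r = (√2−1)/(2K)`, where it equals `1/R₁`. We follow exactly this architecture; the numerical
constants of Lemmas 3, 8–10 are re-derived in the kernel by elementary means (so the additive
constant is `1.645` instead of `1.59`; any constant `> 2K log 17 = 1.566…` serves):

* **Stechkin's lemma in exact form** (`McCurleyStechkin.stechkin_identity`, `stechkin_ratio`,
  `stechkin_real`, `stechkin_complex`; McCurley's Lemma 4 = Stechkin 1970, Lemma 2, for real `s`):
  with `a = x₁+x₂`, `p = x₁x₂`, `p_δ = (x₁+δ)(x₂+δ)`, `D = (x₁²+Y)(x₂²+Y)`, `D_δ` likewise,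
  `(p+Y)D_δ − (p_δ+Y)D = δ(a+δ)(Y² + (6p + δ(a+δ) − a²)Y + p p_δ)`; for McCurley's `σ₁` one has
  `δ(a+δ) = σ` (`σ₁² = σ₁ + σ²`) and `6p + σ − (2σ−1)² ≥ (2σ+1)(σ−1) ≥ 0`, while
  `κ = 1/√5 ≤ (2σ−1)/(2σ₁−1)` iff `(4σ−1)(σ−1) ≥ 0`; hence
  `Re[1/(σ−ρ) + 1/(σ−1+ρ̄)] ≥ κ Re[1/(σ₁−ρ) + 1/(σ₁−1+ρ̄)]` for `0 < Re ρ < 1`, all `Im ρ`, `σ ≥ 1`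
  (the tree's `KadiriStechkinFarZeros.lean` has the large-`|Im ρ|` form only).
* **The `κ`-differenced pair-Hadamard bound** (`DirichletTheta.two_mul_stechkinPair_le`,
  `stechkin_re_logDeriv_xiPair_nonneg`, `re_logDeriv_xiPair_ofReal`, `stechkinDiff_logDeriv_le`,
  `stechkinDiff_logDeriv_le_of_realZero`): for `χ` primitive, `χ ≠ 1`, of parity `a`,
  `Re(−L'/L(σ,χ)) − κRe(−L'/L(σ₁,χ)) ≤ K log q + [Re Γ_ℝ'/Γ_ℝ(σ+a) − κ Re Γ_ℝ'/Γ_ℝ(σ₁+a)] − P(σ,β₁)`,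
  `P(σ,β) = [1/(σ−β) + 1/(σ−1+β)] − κ[1/(σ₁−β) + 1/(σ₁−1+β)]` for a real zero `β₁ ∈ (0,1)∖{½}`
  (and without `P` when no zero is kept) — the proved genus-zero Hadamard product of
  `Ξ_χ = ξ(·,χ)ξ(·,χ̄)` over pairs `{ρ, 1−ρ}` (`DirichletXiPairHadamard.lean` et seq.), every pair
  term being non-negative by Stechkin's lemma (McCurley's Lemmas 8 and 10).
* **Numerics** (`re_digamma_mono`, `re_digamma_le_tangent` — `ψ(x) ≤ −γ + (x−1)π²/6` for all
  `x > 0` from Gauss's series, the concavity step of McCurley's Lemma 3 —, the tree's Stirling-type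
  lower bound `log x − 1/(2x) − 1/(12x²) ≤ ψ(x)`, `γ > 0.57721558`, elementary `exp` bounds):
  on `1 < σ ≤ 1.3` the Gamma terms are `≤ −0.44` (odd) and `≤ −0.67` (even)
  (`gammaTerm_odd_le`, `gammaTerm_even_le`; McCurley: `−0.45699`), and
  `Re(−ζ'/ζ(σ)) − κRe(−ζ'/ζ(σ₁)) ≤ 1/(σ−1) − 0.325` (`zetaTerm_le`, from the tree's
  `neg_logDeriv_riemannZeta_re_le` with all zeros dropped; McCurley: `−0.7833`).
* **The product character** `χ₁χ₂ mod k₁k₂` (`prodChar`; `prodChar_ne_one` from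
  `conductor_changeLevel` and `changeLevel_injective`; `prodChar_isQuadratic`) and the
  **imprimitivity correction** (`fdiff_changeLevel_le`, McCurley's Lemma 9): through Mathlib's
  `LFunction_changeLevel` and the log-derivative of the finite Euler factor
  (`logDeriv_eulerFactor`), per prime `≤ K log p·[ψ(p) ≠ 0]` (`eulerCorr_diff_le`; the prime `2`
  uses `2^{−σ₁} ≥ 1/4`, i.e. `σ₁ ≤ 2`), and the primes with `ψ(p) ≠ 0` multiply to a divisor of
  `N/k'`, whence `f_{ψ mod N} ≤ f_ψ + K log(N/k')`.
* **Positivity (23)** (`positivity_sum`), **(25)** (`main_inequality`: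
  `1/(σ−β₁) + 1/(σ−β₂) − 1/(σ−1) ≤ 2K log(k₁k₂) − 1.645`), **(26)** (`key_identity`:
  `2/(r + 1/R₁) − 1/r = 2K` exactly for `r = (√2−1)/(2K)`; `McCurley1984_theorem2_holds`). The
  principal character mod `1` (allowed by the typed statement) is disposed of by
  `riemannZeta_ne_zero_of_mem_Ioo_holds` (`LevinsonMontgomery.lean`) and Mathlib's
  `riemannZeta_ne_zero_of_one_le_re` (`ne_one_and_lt_one`).

## References

* K. S. McCurley, *Explicit zero-free regions for Dirichlet L-functions*, J. Number Theory 19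
  (1984) 7–32, doi:10.1016/0022-314x(84)90089-1 — §2 (notation, `K`, `σ₁`, `F`), Lemma 3, Lemma 4
  (Stechkin), Lemmas 8–10, §3 (23)–(26), Theorem 2 p. 9. [McCurley1984ZFR]
* S. B. Stečkin, *The zeros of the Riemann zeta-function*, Mat. Zametki 8 (1970) 419–429, Lemma 2
  (cited through McCurley's Lemma 4 and Rosser–Schoenfeld 1975, Lemma 1). [RosserSchoenfeld1975]
* H. L. Montgomery, R. C. Vaughan, *Multiplicative Number Theory I*, §10.2 (10.29), Thm 14.5.
  [MontgomeryVaughan2007]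
* G. E. Andrews, R. Askey, R. Roy, *Special Functions*, Thm 1.2.5 (Gauss's series for `ψ`).
  [AndrewsAskeyRoy1999]
* J. Thorner, A. Zaman, Forum Math. 36 (2024), Lemma 2.4 (the consumer). [ThornerZaman2024LogFree]
-/

noncomputable section

open Real Complex

namespace Literature.NumberTheory.LFunctions

namespace McCurleyStechkin

/-- Stechkin's constant `κ = 1/√5`. [cite: McCurley1984ZFR, §2 p. 10] -/
def kappa : ℝ := (Real.sqrt 5)⁻¹

/-- McCurley's `K = (1 − 1/√5)/2 = (5 − √5)/10`. [cite: McCurley1984ZFR, §2 p. 10] -/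
def bigK : ℝ := (1 - kappa) / 2

/-- Stechkin's companion abscissa `σ₁ = (1 + √(1 + 4σ²))/2`. [cite: McCurley1984ZFR, §2 p. 10] -/
def sigmaOne (σ : ℝ) : ℝ := (1 + Real.sqrt (1 + 4 * σ ^ 2)) / 2

/-- `0 < √5`. [folklore] -/
private theorem sqrt5_pos : 0 < Real.sqrt 5 := Real.sqrt_pos.2 (by norm_num)

/-- `2.236 < √5`. [folklore] -/
private theorem sqrt5_gt : (2.236 : ℝ) < Real.sqrt 5 := by
  rw [show (2.236 : ℝ) = Real.sqrt (2.236 ^ 2) by rw [Real.sqrt_sq (by norm_num)]]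
  exact Real.sqrt_lt_sqrt (by norm_num) (by norm_num)

/-- `√5 < 2.23607`. [folklore] -/
private theorem sqrt5_lt : Real.sqrt 5 < 2.23607 := by
  rw [show (2.23607 : ℝ) = Real.sqrt (2.23607 ^ 2) by rw [Real.sqrt_sq (by norm_num)]]
  exact Real.sqrt_lt_sqrt (by norm_num) (by norm_num)

/-- `(√5)² = 5`. [folklore] -/
private theorem sq_sqrt5 : Real.sqrt 5 ^ 2 = 5 := Real.sq_sqrt (by norm_num)

/-- `κ > 0`. [cite: McCurley1984ZFR, §2 p. 10] -/
theorem kappa_pos : 0 < kappa := inv_pos.2 sqrt5_pos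

/-- `κ√5 = 1`. [cite: McCurley1984ZFR, §2 p. 10] -/
theorem kappa_mul_sqrt5 : kappa * Real.sqrt 5 = 1 := inv_mul_cancel₀ sqrt5_pos.ne'

/-- `κ² = 1/5`. [cite: McCurley1984ZFR, §2 p. 10] -/
theorem kappa_sq : kappa ^ 2 = 1 / 5 := by
  unfold kappa; rw [inv_pow, sq_sqrt5, one_div]

/-- `κ < 0.44723`. [cite: McCurley1984ZFR, §2 p. 10] -/
theorem kappa_lt : kappa < 0.44723 := by
  have h : kappa * Real.sqrt 5 = 1 := kappa_mul_sqrt5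
  nlinarith [sqrt5_gt, kappa_pos]

/-- `κ > 0.44721`. [cite: McCurley1984ZFR, §2 p. 10] -/
theorem kappa_gt : 0.44721 < kappa := by
  have h : kappa * Real.sqrt 5 = 1 := kappa_mul_sqrt5
  nlinarith [sqrt5_lt, kappa_pos]

/-- `κ < 1`. [cite: McCurley1984ZFR, §2 p. 10] -/
theorem kappa_lt_one : kappa < 1 := kappa_lt.trans (by norm_num)

/-- `K > 0`. [cite: McCurley1984ZFR, §2 p. 10] -/
theorem bigK_pos : 0 < bigK := by unfold bigK; linarith [kappa_lt_one]

/-- `K > 0.276385` (`K = 0.2763932…`). [cite: McCurley1984ZFR, §2 p. 10] -/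
theorem bigK_gt : 0.276385 < bigK := by unfold bigK; linarith [kappa_lt]

/-- `K < 0.276395`. [cite: McCurley1984ZFR, §2 p. 10] -/
theorem bigK_lt : bigK < 0.276395 := by unfold bigK; linarith [kappa_gt]

/-! ### The companion abscissa `σ₁` -/

/-- `√(1+4σ²) > 0`. [folklore] -/
private theorem sqrt_one_add_pos (σ : ℝ) : 0 < Real.sqrt (1 + 4 * σ ^ 2) :=
  Real.sqrt_pos.2 (by positivity)

/-- `(√(1+4σ²))² = 1 + 4σ²`. [folklore] -/
private theorem sq_sqrt_one_add (σ : ℝ) : Real.sqrt (1 + 4 * σ ^ 2) ^ 2 = 1 + 4 * σ ^ 2 :=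
  Real.sq_sqrt (by positivity)

/-- `σ₁² = σ₁ + σ²` (the defining relation of Stechkin's abscissa). [cite: McCurley1984ZFR, §2 p. 10] -/
theorem sigmaOne_sq (σ : ℝ) : sigmaOne σ ^ 2 = sigmaOne σ + σ ^ 2 := by
  unfold sigmaOne
  have h := sq_sqrt_one_add σ
  nlinarith [h]

/-- `2σ₁ − 1 = √(1 + 4σ²)`. [cite: McCurley1984ZFR, §2 p. 10] -/
theorem two_mul_sigmaOne_sub_one (σ : ℝ) : 2 * sigmaOne σ - 1 = Real.sqrt (1 + 4 * σ ^ 2) := by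
  unfold sigmaOne; ring

/-- `σ < σ₁` for `σ > 0`. [cite: McCurley1984ZFR, §2 p. 10] -/
theorem lt_sigmaOne {σ : ℝ} (hσ : 0 < σ) : σ < sigmaOne σ := by
  have hu := sqrt_one_add_pos σ
  have h2 := sq_sqrt_one_add σ
  -- `(2σ − 1)² < 1 + 4σ² = u²`
  have : 2 * σ - 1 < Real.sqrt (1 + 4 * σ ^ 2) := by nlinarith
  unfold sigmaOne; linarith

/-- `1 < σ₁` for `σ ≥ 1`. [cite: McCurley1984ZFR, §2 p. 10] -/
theorem one_lt_sigmaOne {σ : ℝ} (hσ : 1 ≤ σ) : 1 < sigmaOne σ :=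
  lt_of_le_of_lt hσ (lt_sigmaOne (by linarith))

/-- `0 < σ₁` for `σ ≥ 1`. [cite: McCurley1984ZFR, §2 p. 10] -/
theorem sigmaOne_pos {σ : ℝ} (hσ : 1 ≤ σ) : 0 < sigmaOne σ := by linarith [one_lt_sigmaOne hσ]

/-- `σ₁ ≤ 2` for `σ ≤ 13/10` (indeed for `σ ≤ √2`). [cite: McCurley1984ZFR, §3 p. 22] -/
theorem sigmaOne_lt_two {σ : ℝ} (hσ0 : 0 ≤ σ) (hσ : σ ≤ 1.3) : sigmaOne σ < 2 := by
  have h2 := sq_sqrt_one_add σ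
  have hu := sqrt_one_add_pos σ
  have hσ2 : σ ^ 2 ≤ 1.69 := by nlinarith
  have : Real.sqrt (1 + 4 * σ ^ 2) < 3 := by nlinarith
  unfold sigmaOne; linarith

/-- `(1 + √5)/2 ≤ σ₁` for `σ ≥ 1`. [cite: McCurley1984ZFR, §2 p. 10] -/
theorem golden_le_sigmaOne {σ : ℝ} (hσ : 1 ≤ σ) : (1 + Real.sqrt 5) / 2 ≤ sigmaOne σ := by
  unfold sigmaOne
  have : Real.sqrt 5 ≤ Real.sqrt (1 + 4 * σ ^ 2) := Real.sqrt_le_sqrt (by nlinarith)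
  linarith

/-- `σ₁ > 1.618` for `σ ≥ 1` (McCurley uses `σ₁/2 ≥ 0.805`). [cite: McCurley1984ZFR, §2 p. 10] -/
theorem sigmaOne_gt_1618 {σ : ℝ} (hσ : 1 ≤ σ) : 1.618 < sigmaOne σ := by
  have := golden_le_sigmaOne hσ
  linarith [sqrt5_gt]

/-- Stechkin's admissibility of `κ = 1/√5`: `κ(2σ₁ − 1) ≤ 2σ − 1` for `σ ≥ 1`
(`⇔ 1 + 4σ² ≤ 5(2σ−1)² ⇔ 4(4σ−1)(σ−1) ≥ 0`). [cite: McCurley1984ZFR, Lemma 4] -/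
theorem kappa_mul_le {σ : ℝ} (hσ : 1 ≤ σ) : kappa * (2 * sigmaOne σ - 1) ≤ 2 * σ - 1 := by
  rw [two_mul_sigmaOne_sub_one]
  have h5 := sqrt5_pos
  have hk := kappa_pos
  have hks := kappa_mul_sqrt5
  -- `√(1+4σ²) ≤ √5 (2σ−1)`
  have hle : Real.sqrt (1 + 4 * σ ^ 2) ≤ Real.sqrt 5 * (2 * σ - 1) := by
    rw [show Real.sqrt 5 * (2 * σ - 1) = Real.sqrt (5 * (2 * σ - 1) ^ 2) by
      rw [Real.sqrt_mul (by norm_num), Real.sqrt_sq (by linarith)]]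
    exact Real.sqrt_le_sqrt (by nlinarith)
  calc kappa * Real.sqrt (1 + 4 * σ ^ 2) ≤ kappa * (Real.sqrt 5 * (2 * σ - 1)) :=
        mul_le_mul_of_nonneg_left hle hk.le
    _ = 2 * σ - 1 := by rw [← mul_assoc, hks, one_mul]

/-- `(σ₁ − σ)(σ₁ + σ − 1) = σ`. [cite: McCurley1984ZFR, §2 p. 10] -/
theorem delta_mul_eq (σ : ℝ) : (sigmaOne σ - σ) * (σ + sigmaOne σ - 1) = σ := by
  have h := sigmaOne_sq σ
  nlinarith [h]

/-! ### Stechkin's lemma (exact form, real abscissa) -/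

/-- The pair identity `x₁/(x₁²+Y) + x₂/(x₂²+Y) = (x₁+x₂)(x₁x₂+Y)/((x₁²+Y)(x₂²+Y))`. [folklore] -/
private theorem pair_eq {x₁ x₂ Y : ℝ} (h₁ : x₁ ^ 2 + Y ≠ 0) (h₂ : x₂ ^ 2 + Y ≠ 0) :
    x₁ / (x₁ ^ 2 + Y) + x₂ / (x₂ ^ 2 + Y) =
      (x₁ + x₂) * (x₁ * x₂ + Y) / ((x₁ ^ 2 + Y) * (x₂ ^ 2 + Y)) := by
  field_simp
  ring

/-- **The Stechkin identity.** With `a = x₁ + x₂`, `p = x₁x₂`, `p_δ = (x₁+δ)(x₂+δ)`,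
`D = (x₁²+Y)(x₂²+Y)`, `D_δ = ((x₁+δ)²+Y)((x₂+δ)²+Y)`:
`(p + Y) D_δ − (p_δ + Y) D = δ(a+δ)(Y² + (6p + δ(a+δ) − a²) Y + p p_δ)`. [cite: McCurley1984ZFR, Lemma 4] -/
theorem stechkin_identity (x₁ x₂ δ Y : ℝ) :
    (x₁ * x₂ + Y) * (((x₁ + δ) ^ 2 + Y) * ((x₂ + δ) ^ 2 + Y)) -
        ((x₁ + δ) * (x₂ + δ) + Y) * ((x₁ ^ 2 + Y) * (x₂ ^ 2 + Y)) =
      δ * (x₁ + x₂ + δ) *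
        (Y ^ 2 + (6 * (x₁ * x₂) + δ * (x₁ + x₂ + δ) - (x₁ + x₂) ^ 2) * Y +
          x₁ * x₂ * ((x₁ + δ) * (x₂ + δ))) := by
  ring

/-- **Stechkin's lemma, ratio form.** For `x₁, x₂ > 0`, `δ ≥ 0`, `Y ≥ 0` with
`6x₁x₂ + δ(x₁+x₂+δ) ≥ (x₁+x₂)²`:
`(x₁+x₂)·[(x₁+δ)/((x₁+δ)²+Y) + (x₂+δ)/((x₂+δ)²+Y)] ≤ (x₁+x₂+2δ)·[x₁/(x₁²+Y) + x₂/(x₂²+Y)]`.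
[cite: McCurley1984ZFR, Lemma 4] -/
theorem stechkin_ratio {x₁ x₂ δ Y : ℝ} (hx₁ : 0 < x₁) (hx₂ : 0 < x₂) (hδ : 0 ≤ δ) (hY : 0 ≤ Y)
    (hcoef : (x₁ + x₂) ^ 2 ≤ 6 * (x₁ * x₂) + δ * (x₁ + x₂ + δ)) :
    (x₁ + x₂) * ((x₁ + δ) / ((x₁ + δ) ^ 2 + Y) + (x₂ + δ) / ((x₂ + δ) ^ 2 + Y)) ≤
      (x₁ + x₂ + 2 * δ) * (x₁ / (x₁ ^ 2 + Y) + x₂ / (x₂ ^ 2 + Y)) := by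
  have hD₁ : 0 < x₁ ^ 2 + Y := by positivity
  have hD₂ : 0 < x₂ ^ 2 + Y := by positivity
  have hE₁ : 0 < (x₁ + δ) ^ 2 + Y := by positivity
  have hE₂ : 0 < (x₂ + δ) ^ 2 + Y := by positivity
  rw [pair_eq hD₁.ne' hD₂.ne', pair_eq hE₁.ne' hE₂.ne',
    show x₁ + δ + (x₂ + δ) = x₁ + x₂ + 2 * δ by ring]
  -- `(p_δ + Y)/D_δ ≤ (p + Y)/D`
  have hkey : ((x₁ + δ) * (x₂ + δ) + Y) / (((x₁ + δ) ^ 2 + Y) * ((x₂ + δ) ^ 2 + Y)) ≤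
      (x₁ * x₂ + Y) / ((x₁ ^ 2 + Y) * (x₂ ^ 2 + Y)) := by
    rw [div_le_div_iff₀ (by positivity) (by positivity)]
    have hid := stechkin_identity x₁ x₂ δ Y
    have hrhs : 0 ≤ δ * (x₁ + x₂ + δ) *
        (Y ^ 2 + (6 * (x₁ * x₂) + δ * (x₁ + x₂ + δ) - (x₁ + x₂) ^ 2) * Y +
          x₁ * x₂ * ((x₁ + δ) * (x₂ + δ))) := by
      have h1 : 0 ≤ δ * (x₁ + x₂ + δ) := by positivity
      have h2 : 0 ≤ (6 * (x₁ * x₂) + δ * (x₁ + x₂ + δ) - (x₁ + x₂) ^ 2) * Y :=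
        mul_nonneg (by linarith) hY
      have h3 : 0 ≤ x₁ * x₂ * ((x₁ + δ) * (x₂ + δ)) := by positivity
      have h4 : 0 ≤ Y ^ 2 := by positivity
      exact mul_nonneg h1 (by linarith)
    linarith
  have ha : 0 ≤ x₁ + x₂ := by positivity
  have ha' : 0 ≤ x₁ + x₂ + 2 * δ := by positivity
  calc (x₁ + x₂) * ((x₁ + x₂ + 2 * δ) * ((x₁ + δ) * (x₂ + δ) + Y) /
          (((x₁ + δ) ^ 2 + Y) * ((x₂ + δ) ^ 2 + Y)))
        = (x₁ + x₂) * (x₁ + x₂ + 2 * δ) * (((x₁ + δ) * (x₂ + δ) + Y) /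
            (((x₁ + δ) ^ 2 + Y) * ((x₂ + δ) ^ 2 + Y))) := by ring
    _ ≤ (x₁ + x₂) * (x₁ + x₂ + 2 * δ) * ((x₁ * x₂ + Y) / ((x₁ ^ 2 + Y) * (x₂ ^ 2 + Y))) :=
        mul_le_mul_of_nonneg_left hkey (by positivity)
    _ = (x₁ + x₂ + 2 * δ) * ((x₁ + x₂) * (x₁ * x₂ + Y) / ((x₁ ^ 2 + Y) * (x₂ ^ 2 + Y))) := by
        ring

/-- **Stechkin's lemma (McCurley's Lemma 4, real abscissa, `t = 0`).** For `σ ≥ 1`, `0 < x < 1`,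
`y ∈ ℝ`, `σ₁ = (1+√(1+4σ²))/2`, `κ = 1/√5`, with `x₁ = σ − x`, `x₂ = σ − 1 + x`:
`κ·[(σ₁−x)/((σ₁−x)²+y²) + (σ₁−1+x)/((σ₁−1+x)²+y²)] ≤ x₁/(x₁²+y²) + x₂/(x₂²+y²)`.
[cite: McCurley1984ZFR, Lemma 4] -/
theorem stechkin_real {σ x y : ℝ} (hσ : 1 ≤ σ) (hx0 : 0 < x) (hx1 : x < 1) :
    kappa * ((sigmaOne σ - x) / ((sigmaOne σ - x) ^ 2 + y ^ 2) +
        (sigmaOne σ - 1 + x) / ((sigmaOne σ - 1 + x) ^ 2 + y ^ 2)) ≤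
      (σ - x) / ((σ - x) ^ 2 + y ^ 2) + (σ - 1 + x) / ((σ - 1 + x) ^ 2 + y ^ 2) := by
  set δ := sigmaOne σ - σ with hδdef
  have hδ : 0 < δ := by have := lt_sigmaOne (show (0:ℝ) < σ by linarith); linarith
  have hx₁ : 0 < σ - x := by linarith
  have hx₂ : 0 < σ - 1 + x := by linarith
  have e1 : sigmaOne σ - x = σ - x + δ := by rw [hδdef]; ring
  have e2 : sigmaOne σ - 1 + x = σ - 1 + x + δ := by rw [hδdef]; ring
  rw [e1, e2]
  -- the coefficient condition: `δ(a + δ) = σ`, `p = σ(σ−1) + x(1−x)`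
  have hcoef : (σ - x + (σ - 1 + x)) ^ 2 ≤
      6 * ((σ - x) * (σ - 1 + x)) + δ * (σ - x + (σ - 1 + x) + δ) := by
    have hd : δ * (σ - x + (σ - 1 + x) + δ) = σ := by
      rw [show σ - x + (σ - 1 + x) + δ = σ + sigmaOne σ - 1 by rw [hδdef]; ring, hδdef]
      exact delta_mul_eq σ
    rw [hd]
    nlinarith [mul_pos hx0 (show 0 < 1 - x by linarith)]
  have hrat := stechkin_ratio hx₁ hx₂ hδ.le (sq_nonneg y) hcoef
  -- `κ (a + 2δ) ≤ a`
  have hκa : kappa * (σ - x + (σ - 1 + x) + 2 * δ) ≤ σ - x + (σ - 1 + x) := by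
    rw [show σ - x + (σ - 1 + x) + 2 * δ = 2 * sigmaOne σ - 1 by rw [hδdef]; ring,
      show σ - x + (σ - 1 + x) = 2 * σ - 1 by ring]
    exact kappa_mul_le hσ
  have hS : 0 ≤ (σ - x + δ) / ((σ - x + δ) ^ 2 + y ^ 2) +
      (σ - 1 + x + δ) / ((σ - 1 + x + δ) ^ 2 + y ^ 2) := by positivity
  have hT : 0 ≤ (σ - x) / ((σ - x) ^ 2 + y ^ 2) + (σ - 1 + x) / ((σ - 1 + x) ^ 2 + y ^ 2) := by
    positivity
  have ha : 0 < σ - x + (σ - 1 + x) := by linarith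
  -- `a·κS ≤ κ(a+2δ) S ≤ ...`: from `a S_δ ≤ (a+2δ) S` and `κ(a+2δ) ≤ a`
  have h1 : (σ - x + (σ - 1 + x)) * (kappa * ((σ - x + δ) / ((σ - x + δ) ^ 2 + y ^ 2) +
      (σ - 1 + x + δ) / ((σ - 1 + x + δ) ^ 2 + y ^ 2))) ≤
      (σ - x + (σ - 1 + x)) * ((σ - x) / ((σ - x) ^ 2 + y ^ 2) +
        (σ - 1 + x) / ((σ - 1 + x) ^ 2 + y ^ 2)) := by
    calc (σ - x + (σ - 1 + x)) * (kappa * ((σ - x + δ) / ((σ - x + δ) ^ 2 + y ^ 2) +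
          (σ - 1 + x + δ) / ((σ - 1 + x + δ) ^ 2 + y ^ 2)))
          = kappa * ((σ - x + (σ - 1 + x)) * ((σ - x + δ) / ((σ - x + δ) ^ 2 + y ^ 2) +
          (σ - 1 + x + δ) / ((σ - 1 + x + δ) ^ 2 + y ^ 2))) := by ring
      _ ≤ kappa * ((σ - x + (σ - 1 + x) + 2 * δ) * ((σ - x) / ((σ - x) ^ 2 + y ^ 2) +
          (σ - 1 + x) / ((σ - 1 + x) ^ 2 + y ^ 2))) :=
          mul_le_mul_of_nonneg_left hrat kappa_pos.le
      _ = kappa * (σ - x + (σ - 1 + x) + 2 * δ) * ((σ - x) / ((σ - x) ^ 2 + y ^ 2) +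
          (σ - 1 + x) / ((σ - 1 + x) ^ 2 + y ^ 2)) := by ring
      _ ≤ (σ - x + (σ - 1 + x)) * ((σ - x) / ((σ - x) ^ 2 + y ^ 2) +
          (σ - 1 + x) / ((σ - 1 + x) ^ 2 + y ^ 2)) := mul_le_mul_of_nonneg_right hκa hT
  exact le_of_mul_le_mul_left h1 ha

/-- Real part of `1/(σ − ρ)` for real `σ`. [folklore] -/
private theorem re_inv_ofReal_sub (σ : ℝ) (ρ : ℂ) :
    (((σ : ℂ) - ρ)⁻¹).re = (σ - ρ.re) / ((σ - ρ.re) ^ 2 + ρ.im ^ 2) := by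
  rw [Complex.inv_re, Complex.normSq_apply]
  simp only [sub_re, ofReal_re, sub_im, ofReal_im, zero_sub]
  ring

/-- Real part of `1/(σ − (1 − ρ))` for real `σ`. [folklore] -/
private theorem re_inv_ofReal_sub_one_sub (σ : ℝ) (ρ : ℂ) :
    (((σ : ℂ) - (1 - ρ))⁻¹).re = (σ - 1 + ρ.re) / ((σ - 1 + ρ.re) ^ 2 + ρ.im ^ 2) := by
  rw [Complex.inv_re, Complex.normSq_apply]
  simp only [sub_re, ofReal_re, sub_im, ofReal_im, one_re, one_im, zero_sub]
  ring

/-- **Stechkin's lemma, complex form**: for `σ ≥ 1` and `0 < Re ρ < 1`,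
`κ·Re[1/(σ₁−ρ) + 1/(σ₁−(1−ρ))] ≤ Re[1/(σ−ρ) + 1/(σ−(1−ρ))]`. [cite: McCurley1984ZFR, Lemma 4] -/
theorem stechkin_complex {σ : ℝ} (hσ : 1 ≤ σ) {ρ : ℂ} (h0 : 0 < ρ.re) (h1 : ρ.re < 1) :
    kappa * ((((sigmaOne σ : ℂ) - ρ)⁻¹).re + (((sigmaOne σ : ℂ) - (1 - ρ))⁻¹).re) ≤
      (((σ : ℂ) - ρ)⁻¹).re + (((σ : ℂ) - (1 - ρ))⁻¹).re := by
  rw [re_inv_ofReal_sub, re_inv_ofReal_sub_one_sub, re_inv_ofReal_sub, re_inv_ofReal_sub_one_sub]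
  exact stechkin_real hσ h0 h1

end McCurleyStechkin

/-! ## The Stechkin-differenced Hadamard bound for the pair `Ξ_χ = ξ(·,χ)ξ(·,χ̄)` -/

namespace DirichletTheta

open McCurleyStechkin

variable {q : ℕ} [NeZero q] {χ : DirichletCharacter ℂ q}

/-- `Ξ_χ(t) ≠ 0` for real `t > 1` (the zeros have real part in `(0,1)`). [cite: MontgomeryVaughan2007, Cor 10.8] -/
private theorem xiPair_ofReal_ne_zero (hχ : χ.IsPrimitive) (h1 : χ ≠ 1) {t : ℝ} (ht : 1 < t) :
    xiPair χ t ≠ 0 := by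
  intro h
  have := (re_mem_Ioo_of_xiPair_eq_zero hχ h1 h).2
  simp only [ofReal_re] at this
  linarith

/-- A real zero of `L(s, χ)` is a zero of `L(s, χ̄)` (`χ ≠ 1`). [cite: MontgomeryVaughan2007, §10.1 p. 334] -/
private theorem LFunction_inv_ofReal_eq_zero' (h1 : χ ≠ 1) {β₁ : ℝ} (hL : χ.LFunction β₁ = 0) :
    χ⁻¹.LFunction β₁ = 0 := by
  have h := DirichletZFR.conj_LFunction_conj χ h1 (β₁ : ℂ)
  rw [Complex.conj_ofReal, hL, map_zero] at h
  exact h.symm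

/-- A real zero `β₁ > 0` of `L(s, χ)` is a zero of `Ξ_χ` (`χ ≠ 1`). [cite: MontgomeryVaughan2007, (10.19)] -/
private theorem xiPair_ofReal_eq_zero' (h1 : χ ≠ 1) {β₁ : ℝ} (hβ0 : 0 < β₁)
    (hL : χ.LFunction β₁ = 0) : xiPair χ β₁ = 0 := by
  have hs : ∀ n : ℕ, (β₁ : ℂ) + charParity χ ≠ -(2 * n) := by
    intro n h
    have h' := congrArg Complex.re h
    simp at h'
    have : (0 : ℝ) ≤ n := Nat.cast_nonneg n
    have hκ : (0 : ℝ) ≤ charParity χ := Nat.cast_nonneg _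
    linarith
  show dirichletXi χ β₁ * dirichletXi χ⁻¹ β₁ = 0
  rw [(dirichletXi_eq_zero_iff h1 hs).2 hL, zero_mul]

/-- `1/(t − β) + 1/(t − (1 − β))` as a complex number is real. [folklore] -/
private theorem inv_add_inv_ofReal' (t β : ℝ) :
    ((t : ℂ) - (β : ℂ))⁻¹ + ((t : ℂ) - (1 - (β : ℂ)))⁻¹ =
      ((1 / (t - β) + 1 / (t - 1 + β) : ℝ) : ℂ) := by
  have e1 : (t : ℂ) - (β : ℂ) = ((t - β : ℝ) : ℂ) := by push_cast; ring
  have e2 : (t : ℂ) - (1 - (β : ℂ)) = ((t - 1 + β : ℝ) : ℂ) := by push_cast; ring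
  rw [e1, e2, ← Complex.ofReal_inv, ← Complex.ofReal_inv, ← Complex.ofReal_add]
  push_cast
  ring

/-- **Stechkin-differenced partial fractions of `Ξ_χ`, with a real zero.** For `χ` primitive,
`χ ≠ 1`, a real zero `β₁ > 0`, `β₁ ≠ ½` of `L(s,χ)`, and real `σ > 1`, with `σ₁ = (1+√(1+4σ²))/2`,
`κ = 1/√5`:
`2·P(σ, β₁) ≤ Re Ξ_χ'/Ξ_χ(σ) − κ Re Ξ_χ'/Ξ_χ(σ₁)`, where
`P(σ,β) = [1/(σ−β) + 1/(σ−1+β)] − κ[1/(σ₁−β) + 1/(σ₁−1+β)]`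
(each Hadamard pair contributes a non-negative amount by Stechkin's lemma; the two indices through
`β₁` contribute `P` each). [cite: McCurley1984ZFR, Lemmas 4, 8, 10] -/
theorem two_mul_stechkinPair_le (hχ : χ.IsPrimitive) (h1 : χ ≠ 1) {β₁ : ℝ} (hβ0 : 0 < β₁)
    (hβhalf : β₁ ≠ 1 / 2) (hL : χ.LFunction β₁ = 0) {σ : ℝ} (hσ : 1 < σ) :
    2 * ((1 / (σ - β₁) + 1 / (σ - 1 + β₁)) -
        kappa * (1 / (sigmaOne σ - β₁) + 1 / (sigmaOne σ - 1 + β₁))) ≤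
      (logDeriv (xiPair χ) σ).re - kappa * (logDeriv (xiPair χ) (sigmaOne σ)).re := by
  classical
  obtain ⟨b, hbs, -, hmult, hprod⟩ := exists_xiPair_hadamardSeq hχ h1
  have h2 : xiPair χ 2 ≠ 0 := xiPair_two_ne_zero hχ h1
  have h1' : χ⁻¹ ≠ 1 := inv_ne_one.mpr h1
  have hσ₁ : 1 < sigmaOne σ := one_lt_sigmaOne hσ.le
  have hΞβ : xiPair χ (β₁ : ℂ) = 0 := xiPair_ofReal_eq_zero' h1 hβ0 hL
  -- the series at a real point `t > 1`
  set T : ℝ → ℕ → ℂ := fun t n ↦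
    -(2 * b n * ((t : ℂ) - 1 / 2)) / (1 - b n * (((t : ℂ) - 1 / 2) ^ 2 - 9 / 4)) with hTdef
  have hT : ∀ {t : ℝ}, 1 < t → logDeriv (xiPair χ) t = ∑' n, T t n :=
    fun ht ↦ logDeriv_xiPair_eq_tsum hbs h2 h1 hprod (xiPair_ofReal_ne_zero hχ h1 ht)
  have hTs : ∀ t : ℝ, Summable (T t) := fun t ↦
    summable_logDeriv_factor hbs (9 / 4) ((t : ℂ) - 1 / 2)
  have hTs' : ∀ t : ℝ, Summable fun n ↦ (T t n).re := fun t ↦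
    (Complex.hasSum_re (hTs t).hasSum).summable
  have hfac : ∀ {t : ℝ}, 1 < t → ∀ n, 1 - b n * (((t : ℂ) - 1 / 2) ^ 2 - 9 / 4) ≠ 0 :=
    fun ht ↦ factor_ne_zero_of_xiPair_ne_zero h2 hprod (xiPair_ofReal_ne_zero hχ h1 ht)
  have hTn : ∀ {t : ℝ}, 1 < t → ∀ n, b n ≠ 0 →
      T t n = ((t : ℂ) - xiPairZero b n)⁻¹ + ((t : ℂ) - (1 - xiPairZero b n))⁻¹ :=
    fun ht n hn ↦ term_eq_inv_add_inv b hn (hfac ht n)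
  have hρ : ∀ n, b n ≠ 0 → 0 < (xiPairZero b n).re ∧ (xiPairZero b n).re < 1 :=
    fun n hn ↦ re_mem_Ioo_of_xiPair_eq_zero hχ h1 (xiPair_xiPairZero h2 hprod hn)
  -- the combined term and its non-negativity (Stechkin's lemma)
  set g : ℕ → ℝ := fun n ↦ (T σ n).re - kappa * (T (sigmaOne σ) n).re with hgdef
  have hnonneg : ∀ n, 0 ≤ g n := by
    intro n
    by_cases hn : b n = 0
    · simp [hgdef, hTdef, hn]
    · simp only [hgdef]
      rw [hTn hσ n hn, hTn hσ₁ n hn, add_re, add_re]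
      obtain ⟨h0, h1''⟩ := hρ n hn
      have := stechkin_complex hσ.le h0 h1''
      linarith
  have hg : HasSum g ((∑' n, (T σ n).re) - kappa * ∑' n, (T (sigmaOne σ) n).re) :=
    (hTs' σ).hasSum.sub (((hTs' (sigmaOne σ)).hasSum).mul_left kappa)
  -- the value of `g` at an index through `β₁`
  set F : ℝ := (1 / (σ - β₁) + 1 / (σ - 1 + β₁)) -
      kappa * (1 / (sigmaOne σ - β₁) + 1 / (sigmaOne σ - 1 + β₁)) with hFdef
  have hvalT : ∀ {t : ℝ}, 1 < t → ∀ n, b n ≠ 0 →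
      (xiPairZero b n = β₁ ∨ 1 - xiPairZero b n = β₁) →
        (T t n).re = 1 / (t - β₁) + 1 / (t - 1 + β₁) := by
    intro t ht n hn h
    rw [hTn ht n hn]
    rcases h with h | h
    · rw [h, inv_add_inv_ofReal', ofReal_re]
    · have e : xiPairZero b n = 1 - (β₁ : ℂ) := by rw [← h]; ring
      rw [e, sub_sub_cancel, add_comm, inv_add_inv_ofReal', ofReal_re]
  have hval : ∀ n, b n ≠ 0 → (xiPairZero b n = β₁ ∨ 1 - xiPairZero b n = β₁) → g n = F := by
    intro n hn h
    simp only [hgdef, hFdef]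
    rw [hvalT hσ n hn h, hvalT hσ₁ n hn h]
  -- the two index sets through `β₁`
  set A : Set ℕ := {k : ℕ | b k ≠ 0 ∧ xiPairZero b k = β₁} with hAdef
  set B : Set ℕ := {k : ℕ | b k ≠ 0 ∧ 1 - xiPairZero b k = β₁} with hBdef
  have hcard : A.ncard + B.ncard =
      DirichletDisc.zeroOrder χ β₁ + DirichletDisc.zeroOrder χ⁻¹ β₁ :=
    ncard_index_add_ncard_index_eq hχ h1 hmult hΞβ
  have hm1 : 0 < DirichletDisc.zeroOrder χ β₁ := (DirichletDisc.zeroOrder_pos_iff χ h1 _).2 hL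
  have hm2 : 0 < DirichletDisc.zeroOrder χ⁻¹ β₁ :=
    (DirichletDisc.zeroOrder_pos_iff χ⁻¹ h1' _).2 (LFunction_inv_ofReal_eq_zero' h1 hL)
  have hAB : Disjoint A B := by
    rw [Set.disjoint_left]
    rintro k ⟨-, hk⟩ ⟨-, hk'⟩
    apply hβhalf
    rw [hk] at hk'
    have h' := congrArg Complex.re hk'
    simp only [sub_re, one_re, ofReal_re] at h'
    linarith
  have hmemF : ∀ k ∈ A ∪ B, g k = F := by
    rintro k (⟨hk0, hk⟩ | ⟨hk0, hk⟩)
    · exact hval k hk0 (Or.inl hk)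
    · exact hval k hk0 (Or.inr hk)
  have htwo : ∃ k₁ k₂ : ℕ, k₁ ≠ k₂ ∧ k₁ ∈ A ∪ B ∧ k₂ ∈ A ∪ B := by
    by_cases hfin : (A ∪ B).Finite
    · have hA : A.Finite := hfin.subset Set.subset_union_left
      have hB : B.Finite := hfin.subset Set.subset_union_right
      have hc : 1 < (A ∪ B).ncard := by
        rw [Set.ncard_union_eq hAB hA hB]; omega
      obtain ⟨k₁, k₂, hk₁, hk₂, hne⟩ := (Set.one_lt_ncard_iff hfin).1 hc
      exact ⟨k₁, k₂, hne, hk₁, hk₂⟩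
    · obtain ⟨k₁, hk₁, k₂, hk₂, hne⟩ := Set.Infinite.nontrivial hfin
      exact ⟨k₁, k₂, hne, hk₁, hk₂⟩
  obtain ⟨k₁, k₂, hne, hk₁, hk₂⟩ := htwo
  have hsub : ∑ n ∈ ({k₁, k₂} : Finset ℕ), g n ≤
      (∑' n, (T σ n).re) - kappa * ∑' n, (T (sigmaOne σ) n).re :=
    sum_le_hasSum _ (fun n _ ↦ hnonneg n) hg
  rw [Finset.sum_pair hne, hmemF k₁ hk₁, hmemF k₂ hk₂] at hsub
  rw [hT hσ, hT hσ₁, Complex.re_tsum (hTs σ), Complex.re_tsum (hTs _)]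
  linarith

/-- **Stechkin-differenced partial fractions of `Ξ_χ`, no zero kept**:
`0 ≤ Re Ξ_χ'/Ξ_χ(σ) − κ Re Ξ_χ'/Ξ_χ(σ₁)` for `χ` primitive, `χ ≠ 1`, real `σ > 1`.
[cite: McCurley1984ZFR, Lemmas 4, 8, 9] -/
theorem stechkin_re_logDeriv_xiPair_nonneg (hχ : χ.IsPrimitive) (h1 : χ ≠ 1) {σ : ℝ}
    (hσ : 1 < σ) :
    0 ≤ (logDeriv (xiPair χ) σ).re - kappa * (logDeriv (xiPair χ) (sigmaOne σ)).re := by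
  classical
  obtain ⟨b, hbs, -, -, hprod⟩ := exists_xiPair_hadamardSeq hχ h1
  have h2 : xiPair χ 2 ≠ 0 := xiPair_two_ne_zero hχ h1
  have hσ₁ : 1 < sigmaOne σ := one_lt_sigmaOne hσ.le
  set T : ℝ → ℕ → ℂ := fun t n ↦
    -(2 * b n * ((t : ℂ) - 1 / 2)) / (1 - b n * (((t : ℂ) - 1 / 2) ^ 2 - 9 / 4)) with hTdef
  have hT : ∀ {t : ℝ}, 1 < t → logDeriv (xiPair χ) t = ∑' n, T t n :=
    fun ht ↦ logDeriv_xiPair_eq_tsum hbs h2 h1 hprod (xiPair_ofReal_ne_zero hχ h1 ht)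
  have hTs : ∀ t : ℝ, Summable (T t) := fun t ↦
    summable_logDeriv_factor hbs (9 / 4) ((t : ℂ) - 1 / 2)
  have hTs' : ∀ t : ℝ, Summable fun n ↦ (T t n).re := fun t ↦
    (Complex.hasSum_re (hTs t).hasSum).summable
  have hfac : ∀ {t : ℝ}, 1 < t → ∀ n, 1 - b n * (((t : ℂ) - 1 / 2) ^ 2 - 9 / 4) ≠ 0 :=
    fun ht ↦ factor_ne_zero_of_xiPair_ne_zero h2 hprod (xiPair_ofReal_ne_zero hχ h1 ht)
  have hTn : ∀ {t : ℝ}, 1 < t → ∀ n, b n ≠ 0 →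
      T t n = ((t : ℂ) - xiPairZero b n)⁻¹ + ((t : ℂ) - (1 - xiPairZero b n))⁻¹ :=
    fun ht n hn ↦ term_eq_inv_add_inv b hn (hfac ht n)
  have hρ : ∀ n, b n ≠ 0 → 0 < (xiPairZero b n).re ∧ (xiPairZero b n).re < 1 :=
    fun n hn ↦ re_mem_Ioo_of_xiPair_eq_zero hχ h1 (xiPair_xiPairZero h2 hprod hn)
  set g : ℕ → ℝ := fun n ↦ (T σ n).re - kappa * (T (sigmaOne σ) n).re with hgdef
  have hnonneg : ∀ n, 0 ≤ g n := by
    intro n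
    by_cases hn : b n = 0
    · simp [hgdef, hTdef, hn]
    · simp only [hgdef]
      rw [hTn hσ n hn, hTn hσ₁ n hn, add_re, add_re]
      obtain ⟨h0, h1''⟩ := hρ n hn
      have := stechkin_complex hσ.le h0 h1''
      linarith
  have hg : HasSum g ((∑' n, (T σ n).re) - kappa * ∑' n, (T (sigmaOne σ) n).re) :=
    (hTs' σ).hasSum.sub (((hTs' (sigmaOne σ)).hasSum).mul_left kappa)
  rw [hT hσ, hT hσ₁, Complex.re_tsum (hTs σ), Complex.re_tsum (hTs _)]
  exact hg.nonneg hnonneg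

/-- `Re Ξ_χ'/Ξ_χ(t) = log q + 2 Re Γ_ℝ'/Γ_ℝ(t + a) + 2 Re L'/L(t, χ)` at a real point `t > 1`
(`ξ'/ξ = ½ log q + Γ_ℝ'/Γ_ℝ + L'/L` for `χ` and `χ̄`, `Re L'/L(t, χ̄) = Re L'/L(t, χ)`).
[cite: MontgomeryVaughan2007, Theorem 14.5 (proof)] -/
theorem re_logDeriv_xiPair_ofReal (hχ : χ.IsPrimitive) (h1 : χ ≠ 1) {t : ℝ} (ht : 1 < t) :
    (logDeriv (xiPair χ) t).re =
      Real.log q + 2 * (logDeriv Gammaℝ ((t : ℂ) + charParity χ)).re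
        + 2 * (logDeriv χ.LFunction t).re := by
  have h1' : χ⁻¹ ≠ 1 := inv_ne_one.mpr h1
  have hχ' : χ⁻¹.IsPrimitive := by
    rw [DirichletCharacter.isPrimitive_def, DirichletCharacter.conductor_inv]; exact hχ
  have htre : 0 < ((t : ℂ)).re := by simp only [ofReal_re]; linarith
  have ht1 : (1 : ℝ) ≤ ((t : ℂ)).re := by simp only [ofReal_re]; exact ht.le
  have hLt : χ.LFunction t ≠ 0 :=
    DirichletCharacter.LFunction_ne_zero_of_one_le_re χ (Or.inl h1) ht1
  have hLt' : χ⁻¹.LFunction t ≠ 0 :=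
    DirichletCharacter.LFunction_ne_zero_of_one_le_re χ⁻¹ (Or.inl h1') ht1
  have hξ : dirichletXi χ t ≠ 0 := dirichletXi_ne_zero_of_not_mem_strip hχ h1 (Or.inr ht1)
  have hξ' : dirichletXi χ⁻¹ t ≠ 0 := dirichletXi_ne_zero_of_not_mem_strip hχ' h1' (Or.inr ht1)
  have hmul : logDeriv (xiPair χ) t = logDeriv (dirichletXi χ) t + logDeriv (dirichletXi χ⁻¹) t := by
    have hfun : xiPair χ = fun s ↦ dirichletXi χ s * dirichletXi χ⁻¹ s := rfl
    rw [hfun, logDeriv_mul (t : ℂ) hξ hξ' (differentiable_dirichletXi h1 _)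
      (differentiable_dirichletXi h1' _)]
  have e1 : logDeriv (dirichletXi χ) t =
      (Real.log q : ℂ) / 2 + logDeriv Gammaℝ ((t : ℂ) + charParity χ) + logDeriv χ.LFunction t := by
    rw [logDeriv_apply]; exact logDeriv_dirichletXi_eq h1 htre hLt
  have e2 : logDeriv (dirichletXi χ⁻¹) t =
      (Real.log q : ℂ) / 2 + logDeriv Gammaℝ ((t : ℂ) + charParity χ) + logDeriv χ⁻¹.LFunction t := by
    rw [logDeriv_apply, ← charParity_inv χ]; exact logDeriv_dirichletXi_eq h1' htre hLt'
  have hconj : (logDeriv χ⁻¹.LFunction t).re = (logDeriv χ.LFunction t).re := by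
    have h := logDeriv_LFunction_conj (χ := χ) h1 (t : ℂ)
    rw [Complex.conj_ofReal] at h
    rw [h, Complex.conj_re]
  have hre := congrArg Complex.re hmul
  rw [e1, e2] at hre
  simp only [add_re, div_ofNat_re, ofReal_re] at hre
  rw [hconj] at hre
  linarith

/-- **McCurley's Lemma 8/9 in Stechkin-differenced form (no zero kept).** For `χ` primitive mod `q`,
`χ ≠ 1`, parity `a`, real `σ > 1`, `σ₁ = (1+√(1+4σ²))/2`, `κ = 1/√5`, `K = (1−κ)/2`:
`Re(−L'/L(σ,χ)) − κ Re(−L'/L(σ₁,χ)) ≤ K log q + [Re Γ_ℝ'/Γ_ℝ(σ+a) − κ Re Γ_ℝ'/Γ_ℝ(σ₁+a)]`.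
[cite: McCurley1984ZFR, Lemmas 8–9] -/
theorem stechkinDiff_logDeriv_le (hχ : χ.IsPrimitive) (h1 : χ ≠ 1) {σ : ℝ} (hσ : 1 < σ) :
    (-logDeriv χ.LFunction σ).re - kappa * (-logDeriv χ.LFunction (sigmaOne σ)).re ≤
      bigK * Real.log q + ((logDeriv Gammaℝ ((σ : ℂ) + charParity χ)).re
        - kappa * (logDeriv Gammaℝ ((sigmaOne σ : ℂ) + charParity χ)).re) := by
  have hσ₁ : 1 < sigmaOne σ := one_lt_sigmaOne hσ.le
  have h0 := stechkin_re_logDeriv_xiPair_nonneg hχ h1 hσ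
  rw [re_logDeriv_xiPair_ofReal hχ h1 hσ, re_logDeriv_xiPair_ofReal hχ h1 hσ₁] at h0
  rw [neg_re, neg_re]
  unfold bigK
  nlinarith [h0, kappa_pos]

/-- **McCurley's Lemma 10 in Stechkin-differenced form (the real zero and its partner kept).**
With a real zero `β₁ > 0`, `β₁ ≠ ½` of `L(s,χ)`:
`Re(−L'/L(σ,χ)) − κ Re(−L'/L(σ₁,χ)) ≤ K log q + [Γ-terms] − P(σ, β₁)`.
[cite: McCurley1984ZFR, Lemma 10] -/
theorem stechkinDiff_logDeriv_le_of_realZero (hχ : χ.IsPrimitive) (h1 : χ ≠ 1) {β₁ : ℝ}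
    (hβ0 : 0 < β₁) (hβhalf : β₁ ≠ 1 / 2) (hL : χ.LFunction β₁ = 0) {σ : ℝ} (hσ : 1 < σ) :
    (-logDeriv χ.LFunction σ).re - kappa * (-logDeriv χ.LFunction (sigmaOne σ)).re ≤
      bigK * Real.log q + ((logDeriv Gammaℝ ((σ : ℂ) + charParity χ)).re
        - kappa * (logDeriv Gammaℝ ((sigmaOne σ : ℂ) + charParity χ)).re)
      - ((1 / (σ - β₁) + 1 / (σ - 1 + β₁)) -
          kappa * (1 / (sigmaOne σ - β₁) + 1 / (sigmaOne σ - 1 + β₁))) := by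
  have hσ₁ : 1 < sigmaOne σ := one_lt_sigmaOne hσ.le
  have h0 := two_mul_stechkinPair_le hχ h1 hβ0 hβhalf hL hσ
  rw [re_logDeriv_xiPair_ofReal hχ h1 hσ, re_logDeriv_xiPair_ofReal hχ h1 hσ₁] at h0
  rw [neg_re, neg_re]
  unfold bigK
  nlinarith [h0, kappa_pos]

end DirichletTheta


/-! ## Real digamma: the Gauss series, monotonicity, tangent and Stirling bounds; numerics -/

namespace McCurleyStechkin

open Literature.Analysis.SpecialFunctions

/-- Gauss's series on the real axis: `Σ_k (1/(k+1) − 1/(x+k)) = ψ(x) + γ` (`x > 0`).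
[cite: AndrewsAskeyRoy1999, Thm 1.2.5 (1.2.13)] -/
theorem hasSum_re_digamma {x : ℝ} (hx : 0 < x) :
    HasSum (fun k : ℕ ↦ 1 / ((k : ℝ) + 1) - 1 / (x + k))
      ((Complex.digamma x).re + Real.eulerMascheroniConstant) := by
  have hw : 0 < ((x : ℂ)).re := by simp only [ofReal_re]; exact hx
  have h := Literature.Analysis.SpecialFunctions.Complex.hasSum_one_div_sub_one_div_digamma hw
  have e : ∀ k : ℕ, (1 / ((k : ℂ) + 1) - 1 / ((x : ℂ) + k)) =
      (((1 / ((k : ℝ) + 1) - 1 / (x + k) : ℝ)) : ℂ) := by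
    intro k; push_cast; ring
  simp_rw [e] at h
  have h' := Complex.hasSum_re h
  simp only [ofReal_re, add_re] at h'
  exact h'

/-- Real `ψ` is increasing on `(0, ∞)` (termwise from Gauss's series).
[cite: AndrewsAskeyRoy1999, Thm 1.2.5 (1.2.13)] -/
theorem re_digamma_mono {x y : ℝ} (hx : 0 < x) (hxy : x ≤ y) :
    (Complex.digamma x).re ≤ (Complex.digamma y).re := by
  have h1 := hasSum_re_digamma hx
  have h2 := hasSum_re_digamma (lt_of_lt_of_le hx hxy)
  have h := hasSum_le (fun k ↦ ?_) h1 h2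
  · linarith
  · have hxk : 0 < x + k := by positivity
    have : 1 / (y + k) ≤ 1 / (x + k) := one_div_le_one_div_of_le hxk (by linarith)
    linarith

/-- The tangent bound at `1` (concavity of `ψ`): `ψ(x) ≤ −γ + (x−1)·π²/6` for every `x > 0`
(`1/(k+1) − 1/(x+k) ≤ (x−1)/(k+1)²` termwise; `Σ 1/(k+1)² = π²/6`). [cite: McCurley1984ZFR, Lemma 3 (proof)] -/
theorem re_digamma_le_tangent {x : ℝ} (hx : 0 < x) :
    (Complex.digamma x).re ≤ -Real.eulerMascheroniConstant + (x - 1) * (π ^ 2 / 6) := by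
  have h1 := hasSum_re_digamma hx
  have h2 : HasSum (fun m : ℕ ↦ (x - 1) * (1 / ((m : ℝ) + 1) ^ 2)) ((x - 1) * (π ^ 2 / 6)) :=
    hasSum_one_div_nat_add_one_sq.mul_left (x - 1)
  have h := hasSum_le (fun k ↦ ?_) h1 h2
  · linarith
  · have hk1 : (0 : ℝ) < (k : ℝ) + 1 := by positivity
    have hxk : 0 < x + k := by positivity
    have e : 1 / ((k : ℝ) + 1) - 1 / (x + k) = (x - 1) / (((k : ℝ) + 1) * (x + k)) := by
      field_simp; ring
    rw [e, mul_one_div, div_le_div_iff₀ (by positivity) (by positivity)]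
    nlinarith [sq_nonneg (x - 1), hk1, hxk]

/-! ### Elementary logarithms -/

/-- `exp 1.144 ≤ π`, i.e. `1.144 ≤ log π`. [folklore] -/
private theorem log_pi_ge : (1.144 : ℝ) ≤ Real.log π := by
  rw [Real.le_log_iff_exp_le Real.pi_pos]
  have h1 : Real.exp 1.144 = Real.exp 1 * Real.exp 0.144 := by rw [← Real.exp_add]; norm_num
  have h2 : Real.exp 0.144 ≤ 1.1549 := by
    have h := Real.exp_bound' (x := (0.144 : ℝ)) (by norm_num) (by norm_num) (n := 4) (by norm_num)
    refine h.trans ?_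
    simp only [Finset.sum_range_succ, Finset.sum_range_zero, Nat.factorial]
    norm_num
  rw [h1]
  have := Real.exp_one_lt_d9
  have := Real.pi_gt_d6
  nlinarith [Real.exp_pos 0.144]

/-- `2.5 ≤ log 13`. [folklore] -/
private theorem log_thirteen_ge : (2.5 : ℝ) ≤ Real.log 13 := by
  rw [Real.le_log_iff_exp_le (by norm_num)]
  have h1 : Real.exp 2.5 = Real.exp 1 ^ 2 * Real.exp 0.5 := by
    rw [← Real.exp_nat_mul, ← Real.exp_add]; norm_num
  have h2 : Real.exp 0.5 ≤ 1.6488 := by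
    have h := Real.exp_bound' (x := (0.5 : ℝ)) (by norm_num) (by norm_num) (n := 6) (by norm_num)
    refine h.trans ?_
    simp only [Finset.sum_range_succ, Finset.sum_range_zero, Nat.factorial]
    norm_num
  rw [h1]
  have he := Real.exp_one_lt_d9
  have he0 := Real.exp_pos (1 : ℝ)
  have : Real.exp 1 ^ 2 ≤ 2.7182818286 ^ 2 := pow_le_pow_left₀ he0.le he.le 2
  nlinarith [Real.exp_pos (0.5 : ℝ)]

/-- `log 17 ≤ 2.84`. [folklore] -/
private theorem log_seventeen_le : Real.log 17 ≤ 2.84 := by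
  rw [Real.log_le_iff_le_exp (by norm_num)]
  have h1 : Real.exp 2.84 = Real.exp 1 ^ 2 * Real.exp 0.84 := by
    rw [← Real.exp_nat_mul, ← Real.exp_add]; norm_num
  have h2 : (2.316 : ℝ) ≤ Real.exp 0.84 := by
    have h := Real.sum_le_exp_of_nonneg (x := (0.84 : ℝ)) (by norm_num) 7
    refine le_trans ?_ h
    simp only [Finset.sum_range_succ, Finset.sum_range_zero, Nat.factorial]
    norm_num
  rw [h1]
  have he := Real.exp_one_gt_d9
  have : (2.7182818283 : ℝ) ^ 2 ≤ Real.exp 1 ^ 2 := pow_le_pow_left₀ (by norm_num) he.le 2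
  nlinarith

/-- `0.2622 ≤ log(13/10)`. [folklore] -/
private theorem log_13_div_10_ge : (0.2622 : ℝ) ≤ Real.log (13 / 10) := by
  rw [Real.le_log_iff_exp_le (by norm_num)]
  have h := Real.exp_bound' (x := (0.2622 : ℝ)) (by norm_num) (by norm_num) (n := 5) (by norm_num)
  refine h.trans ?_
  simp only [Finset.sum_range_succ, Finset.sum_range_zero, Nat.factorial]
  norm_num

/-- `−0.2235 ≤ log(4/5)`. [folklore] -/
private theorem log_4_div_5_ge : (-0.2235 : ℝ) ≤ Real.log (4 / 5) := by
  have h45 : Real.log (4 / 5) = -Real.log (5 / 4) := by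
    rw [← Real.log_inv]; norm_num
  rw [h45, neg_le_neg_iff, Real.log_le_iff_le_exp (by norm_num)]
  have h := Real.sum_le_exp_of_nonneg (x := (0.2235 : ℝ)) (by norm_num) 4
  refine le_trans ?_ h
  simp only [Finset.sum_range_succ, Finset.sum_range_zero, Nat.factorial]
  norm_num

/-! ### Numerical digamma bounds -/

/-- `ψ(x) ≤ −0.3304` for `0 < x ≤ 1.15`. [cite: McCurley1984ZFR, Lemma 8 (proof)] -/
theorem re_digamma_le_at_115 {x : ℝ} (hx : 0 < x) (hx' : x ≤ 1.15) :
    (Complex.digamma x).re ≤ -0.3304 := by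
  have h1 := re_digamma_mono hx hx'
  have h2 := re_digamma_le_tangent (x := (1.15 : ℝ)) (by norm_num)
  have hγ := Literature.Analysis.SpecialFunctions.Real.eulerMascheroniConstant_gt_d8
  have hπ := Real.pi_lt_d6
  have hπ0 := Real.pi_pos
  have : π ^ 2 ≤ 3.141593 ^ 2 := pow_le_pow_left₀ hπ0.le hπ.le 2
  nlinarith

/-- `ψ(x) ≤ −1.1529` for `0 < x ≤ 0.65`. [cite: McCurley1984ZFR, Lemma 8 (proof)] -/
theorem re_digamma_le_at_065 {x : ℝ} (hx : 0 < x) (hx' : x ≤ 0.65) :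
    (Complex.digamma x).re ≤ -1.1529 := by
  have h1 := re_digamma_mono hx hx'
  have h2 := re_digamma_le_tangent (x := (0.65 : ℝ)) (by norm_num)
  have hγ := Literature.Analysis.SpecialFunctions.Real.eulerMascheroniConstant_gt_d8
  have hπ := Real.pi_gt_d6
  have : (3.141592 : ℝ) ^ 2 ≤ π ^ 2 := pow_le_pow_left₀ (by norm_num) hπ.le 2
  nlinarith

/-- `ψ(x) ≤ 0.492` for `0 < x ≤ 1.65`. [cite: McCurley1984ZFR, Lemma 3 (proof)] -/
theorem re_digamma_le_at_165 {x : ℝ} (hx : 0 < x) (hx' : x ≤ 1.65) :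
    (Complex.digamma x).re ≤ 0.492 := by
  have h1 := re_digamma_mono hx hx'
  have h2 := re_digamma_le_tangent (x := (1.65 : ℝ)) (by norm_num)
  have hγ := Literature.Analysis.SpecialFunctions.Real.eulerMascheroniConstant_gt_d8
  have hπ := Real.pi_lt_d6
  have hπ0 := Real.pi_pos
  have : π ^ 2 ≤ 3.141593 ^ 2 := pow_le_pow_left₀ hπ0.le hπ.le 2
  nlinarith

/-- `−0.1718 ≤ ψ(x)` for `x ≥ 1.3` (Stirling-type lower bound at `1.3`, then monotonicity).
[cite: McCurley1984ZFR, Lemma 8 (proof)] -/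
theorem re_digamma_ge_at_13 {x : ℝ} (hx : 1.3 ≤ x) : (-0.1718 : ℝ) ≤ (Complex.digamma x).re := by
  have hx' : (13 : ℝ) / 10 ≤ x := by norm_num at hx ⊢; linarith
  have h1 := re_digamma_mono (x := (13 : ℝ) / 10) (by norm_num) hx'
  have h2 := Literature.Analysis.SpecialFunctions.Real.log_sub_le_re_digamma
    (x := (13 : ℝ) / 10) (by norm_num)
  have h3 := log_13_div_10_ge
  set y := (Complex.digamma (((13 : ℝ) / 10 : ℝ) : ℂ)).re with hy
  have h4 : Real.log (13 / 10) - 5 / 13 - 25 / 507 ≤ y := by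
    have := h2; norm_num at this ⊢; linarith
  norm_num at h3 ⊢
  linarith

/-- `−0.9788 ≤ ψ(x)` for `x ≥ 0.8`. [cite: McCurley1984ZFR, Lemma 8 (proof)] -/
theorem re_digamma_ge_at_08 {x : ℝ} (hx : 0.8 ≤ x) : (-0.9788 : ℝ) ≤ (Complex.digamma x).re := by
  have hx' : (4 : ℝ) / 5 ≤ x := by norm_num at hx ⊢; linarith
  have h1 := re_digamma_mono (x := (4 : ℝ) / 5) (by norm_num) hx'
  have h2 := Literature.Analysis.SpecialFunctions.Real.log_sub_le_re_digamma
    (x := (4 : ℝ) / 5) (by norm_num)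
  have h3 := log_4_div_5_ge
  set y := (Complex.digamma (((4 : ℝ) / 5 : ℝ) : ℂ)).re with hy
  have h4 : Real.log (4 / 5) - 5 / 8 - 25 / 192 ≤ y := by
    have := h2; norm_num at this ⊢; linarith
  norm_num at h3 ⊢
  linarith

/-! ### The Gamma-factor terms `Re Γ_ℝ'/Γ_ℝ(σ + a) − κ Re Γ_ℝ'/Γ_ℝ(σ₁ + a)` -/

/-- `Re Γ_ℝ'/Γ_ℝ(t) = −½ log π + ½ ψ(t/2)` for real `t > 0`. [folklore] -/
private theorem re_logDeriv_Gammaℝ_ofReal {t : ℝ} (ht : 0 < t) :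
    (logDeriv Gammaℝ (t : ℂ)).re = -Real.log π / 2 + (Complex.digamma ((t / 2 : ℝ) : ℂ)).re / 2 := by
  have hs : ∀ m : ℕ, (t : ℂ) / 2 ≠ -m := by
    intro m h
    have := congrArg Complex.re h
    simp at this
    have : (0 : ℝ) ≤ m := Nat.cast_nonneg m
    linarith
  rw [Literature.NumberTheory.LFunctions.logDeriv_Gammaℝ hs]
  have e : (t : ℂ) / 2 = ((t / 2 : ℝ) : ℂ) := by push_cast; ring
  rw [e, add_re, neg_div, neg_re, div_ofNat_re, div_ofNat_re, ← Complex.ofReal_log Real.pi_pos.le,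
    ofReal_re]
  ring

/-- **Even parity**: for `1 < σ ≤ 1.3`,
`Re Γ_ℝ'/Γ_ℝ(σ) − κ Re Γ_ℝ'/Γ_ℝ(σ₁) ≤ −0.67` (`ψ(σ/2) ≤ ψ(0.65)`, `ψ(σ₁/2) ≥ ψ(0.8)`).
[cite: McCurley1984ZFR, Lemma 8 (proof)] -/
theorem gammaTerm_even_le {σ : ℝ} (hσ : 1 < σ) (hσ' : σ ≤ 1.3) :
    (logDeriv Gammaℝ (σ : ℂ)).re - kappa * (logDeriv Gammaℝ (sigmaOne σ : ℂ)).re ≤ -0.67 := by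
  have hσ₁ := sigmaOne_gt_1618 hσ.le
  rw [re_logDeriv_Gammaℝ_ofReal (by linarith), re_logDeriv_Gammaℝ_ofReal (by linarith)]
  have hA := re_digamma_le_at_065 (x := σ / 2) (by linarith) (by linarith)
  have hB := re_digamma_ge_at_08 (x := sigmaOne σ / 2) (by linarith)
  have hk1 := kappa_lt
  have hk2 := kappa_gt
  have hlp := log_pi_ge
  have hlp' := Literature.Analysis.SpecialFunctions.Real.log_pi_le
  nlinarith

/-- **Odd parity**: for `1 < σ ≤ 1.3`,
`Re Γ_ℝ'/Γ_ℝ(σ+1) − κ Re Γ_ℝ'/Γ_ℝ(σ₁+1) ≤ −0.44` (`ψ((σ+1)/2) ≤ ψ(1.15)`, `ψ((σ₁+1)/2) ≥ ψ(1.3)`).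
[cite: McCurley1984ZFR, Lemma 8 (proof)] -/
theorem gammaTerm_odd_le {σ : ℝ} (hσ : 1 < σ) (hσ' : σ ≤ 1.3) :
    (logDeriv Gammaℝ ((σ : ℂ) + 1)).re - kappa * (logDeriv Gammaℝ ((sigmaOne σ : ℂ) + 1)).re ≤
      -0.44 := by
  have hσ₁ := sigmaOne_gt_1618 hσ.le
  have e1 : (σ : ℂ) + 1 = ((σ + 1 : ℝ) : ℂ) := by push_cast; ring
  have e2 : (sigmaOne σ : ℂ) + 1 = ((sigmaOne σ + 1 : ℝ) : ℂ) := by push_cast; ring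
  rw [e1, e2, re_logDeriv_Gammaℝ_ofReal (by linarith), re_logDeriv_Gammaℝ_ofReal (by linarith)]
  have hA := re_digamma_le_at_115 (x := (σ + 1) / 2) (by linarith) (by linarith)
  have hB := re_digamma_ge_at_13 (x := (sigmaOne σ + 1) / 2) (by linarith)
  have hk1 := kappa_lt
  have hk2 := kappa_gt
  have hlp := log_pi_ge
  have hlp' := Literature.Analysis.SpecialFunctions.Real.log_pi_le
  nlinarith

/-! ### The Riemann zeta term -/

open LSeries ArithmeticFunction in
open scoped LSeries.notation in
/-- `Re(−ζ'/ζ(t)) ≥ 0` for real `t > 1` (`−ζ'/ζ(t) = Σ Λ(n) n^{−t}`, non-negative terms).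
[cite: MontgomeryVaughan2007, (1.22)] -/
theorem re_neg_logDeriv_zeta_nonneg {t : ℝ} (ht : 1 < t) :
    0 ≤ (-(deriv riemannZeta t / riemannZeta t)).re := by
  have hs : 1 < ((t : ℂ)).re := by simp only [ofReal_re]; exact ht
  have hζ : -(deriv riemannZeta t / riemannZeta t) = LSeries ↗Λ t := by
    rw [ArithmeticFunction.LSeries_vonMangoldt_eq_deriv_riemannZeta_div hs, neg_div]
  have hsum : LSeriesSummable ↗Λ t := ArithmeticFunction.LSeriesSummable_vonMangoldt hs
  rw [hζ, LSeries, Complex.re_tsum hsum]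
  refine tsum_nonneg fun n ↦ ?_
  rcases Nat.eq_zero_or_pos n with rfl | hn
  · simp [LSeries.term_zero]
  · have hpow : (n : ℂ) ^ (t : ℂ) = (((n : ℝ) ^ t : ℝ) : ℂ) := by
      rw [Complex.ofReal_cpow (Nat.cast_nonneg n), Complex.ofReal_natCast]
    rw [LSeries.term_of_ne_zero hn.ne', hpow, ← Complex.ofReal_div, Complex.ofReal_re]
    exact div_nonneg ArithmeticFunction.vonMangoldt_nonneg (by positivity)

/-- **McCurley's Lemma 3 in our constants**: for `1 < σ ≤ 1.3`,
`Re(−ζ'/ζ(σ)) − κ Re(−ζ'/ζ(σ₁)) ≤ 1/(σ−1) − 0.325`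
(de la Vallée Poussin's bound `−ζ'/ζ(σ) ≤ 1/(σ−1) − ½log π + ½ψ(σ/2+1)` with all zeros dropped,
`ψ(σ/2+1) ≤ ψ(1.65) ≤ 0.492`, and `−ζ'/ζ(σ₁) ≥ 0`). [cite: McCurley1984ZFR, Lemma 3] -/
theorem zetaTerm_le {σ : ℝ} (hσ : 1 < σ) (hσ' : σ ≤ 1.3) :
    (-(deriv riemannZeta σ / riemannZeta σ)).re -
        kappa * (-(deriv riemannZeta (sigmaOne σ) / riemannZeta (sigmaOne σ))).re ≤
      1 / (σ - 1) - 0.325 := by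
  have h1 := neg_logDeriv_riemannZeta_re_le hσ
  have h2 := re_neg_logDeriv_zeta_nonneg (one_lt_sigmaOne hσ.le)
  have e : (σ : ℂ) / 2 + 1 = ((σ / 2 + 1 : ℝ) : ℂ) := by push_cast; ring
  rw [e] at h1
  have h3 := re_digamma_le_at_165 (x := σ / 2 + 1) (by linarith) (by linarith)
  have hlp := log_pi_ge
  nlinarith [kappa_pos]

end McCurleyStechkin

/-! ## The Stechkin-differenced quantity as a Dirichlet series; the product character `χ₁χ₂` -/

namespace McCurleyStechkin

open LSeries ArithmeticFunction DirichletCharacter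
open scoped LSeries.notation

/-- McCurley's `f(σ, χ) − f(σ₁, χ)/√5` (real parts):
`f_χ(σ) := Re(−L'/L(σ, χ)) − κ Re(−L'/L(σ₁, χ))`. [cite: McCurley1984ZFR, §2 (5)] -/
def fdiff {q : ℕ} [NeZero q] (χ : DirichletCharacter ℂ q) (σ : ℝ) : ℝ :=
  (-(deriv χ.LFunction σ / χ.LFunction σ)).re
    - kappa * (-(deriv χ.LFunction (sigmaOne σ) / χ.LFunction (sigmaOne σ))).re

/-- The same for `ζ`: `f_ζ(σ) := Re(−ζ'/ζ(σ)) − κ Re(−ζ'/ζ(σ₁))`. [cite: McCurley1984ZFR, §2 (5)] -/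
def fdiffZeta (σ : ℝ) : ℝ :=
  (-(deriv riemannZeta σ / riemannZeta σ)).re
    - kappa * (-(deriv riemannZeta (sigmaOne σ) / riemannZeta (sigmaOne σ))).re

/-- `fdiff` in `logDeriv` form. [folklore] -/
private theorem fdiff_eq_logDeriv {q : ℕ} [NeZero q] (χ : DirichletCharacter ℂ q) (σ : ℝ) :
    fdiff χ σ = (-logDeriv χ.LFunction σ).re - kappa * (-logDeriv χ.LFunction (sigmaOne σ)).re := by
  simp only [fdiff, logDeriv_apply]

section Series

variable {q : ℕ} [NeZero q]

omit [NeZero q] in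
/-- `Re(χ(n)Λ(n) n^{−t}) = Λ(n) Re χ(n)/n^t` for real `t`. [folklore] -/
private theorem re_term_twist (χ : DirichletCharacter ℂ q) (t : ℝ) (n : ℕ) :
    (LSeries.term (↗χ * ↗Λ) t n).re = (Λ n : ℝ) * (χ (n : ZMod q)).re / (n : ℝ) ^ t := by
  rcases Nat.eq_zero_or_pos n with rfl | hn
  · simp [LSeries.term_zero]
  have hpow : (n : ℂ) ^ (t : ℂ) = (((n : ℝ) ^ t : ℝ) : ℂ) := by
    rw [Complex.ofReal_cpow (Nat.cast_nonneg n), Complex.ofReal_natCast]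
  simp only [LSeries.term_of_ne_zero hn.ne', Pi.mul_apply]
  rw [hpow, mul_div_assoc, ← Complex.ofReal_div, Complex.re_mul_ofReal]
  ring

/-- `Σ_n Λ(n) Re χ(n)/n^t = Re(−L'/L(t, χ))` for real `t > 1`. [cite: MontgomeryVaughan2007, (4.25)] -/
theorem hasSum_re_twist (χ : DirichletCharacter ℂ q) {t : ℝ} (ht : 1 < t) :
    HasSum (fun n : ℕ ↦ (Λ n : ℝ) * (χ (n : ZMod q)).re / (n : ℝ) ^ t)
      ((-(deriv χ.LFunction t / χ.LFunction t)).re) := by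
  have hs : 1 < ((t : ℂ)).re := by simp only [ofReal_re]; exact ht
  rw [DirichletZFR.neg_logDeriv_LFunction_eq χ hs]
  have hsum : LSeriesSummable (↗χ * ↗Λ) t :=
    DirichletCharacter.LSeriesSummable_twist_vonMangoldt χ hs
  have h := Complex.hasSum_re hsum.hasSum
  simp only [re_term_twist] at h
  exact h

/-- `Σ_n Λ(n)/n^t = Re(−ζ'/ζ(t))` for real `t > 1`. [cite: MontgomeryVaughan2007, (1.22)] -/
theorem hasSum_vonMangoldt_zeta {t : ℝ} (ht : 1 < t) :
    HasSum (fun n : ℕ ↦ (Λ n : ℝ) / (n : ℝ) ^ t)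
      ((-(deriv riemannZeta t / riemannZeta t)).re) := by
  have hs : 1 < ((t : ℂ)).re := by simp only [ofReal_re]; exact ht
  have hζ : -(deriv riemannZeta t / riemannZeta t) = LSeries ↗Λ t := by
    rw [ArithmeticFunction.LSeries_vonMangoldt_eq_deriv_riemannZeta_div hs, neg_div]
  rw [hζ]
  have hsum : LSeriesSummable ↗Λ t := ArithmeticFunction.LSeriesSummable_vonMangoldt hs
  have h := Complex.hasSum_re hsum.hasSum
  have e : ∀ n : ℕ, (LSeries.term ↗Λ t n).re = (Λ n : ℝ) / (n : ℝ) ^ t := by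
    intro n
    rcases Nat.eq_zero_or_pos n with rfl | hn
    · simp [LSeries.term_zero]
    have hpow : (n : ℂ) ^ (t : ℂ) = (((n : ℝ) ^ t : ℝ) : ℂ) := by
      rw [Complex.ofReal_cpow (Nat.cast_nonneg n), Complex.ofReal_natCast]
    rw [LSeries.term_of_ne_zero hn.ne', hpow, ← Complex.ofReal_div, Complex.ofReal_re]
  simp only [e] at h
  exact h

end Series

/-! ### The product character -/

section Product

variable {k₁ k₂ : ℕ} [NeZero k₁] [NeZero k₂]

/-- `χ₁χ₂` as a character modulo `k₁k₂` (possibly imprimitive). [cite: McCurley1984ZFR, §3] -/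
def prodChar (χ₁ : DirichletCharacter ℂ k₁) (χ₂ : DirichletCharacter ℂ k₂) :
    DirichletCharacter ℂ (k₁ * k₂) :=
  changeLevel (dvd_mul_right k₁ k₂) χ₁ * changeLevel (dvd_mul_left k₂ k₁) χ₂

omit [NeZero k₁] [NeZero k₂] in
/-- `(χ₁χ₂)(n) = χ₁(n) χ₂(n)` for every natural `n`. [cite: McCurley1984ZFR, §3 (23)] -/
theorem prodChar_apply_natCast (χ₁ : DirichletCharacter ℂ k₁) (χ₂ : DirichletCharacter ℂ k₂) (n : ℕ) :
    prodChar χ₁ χ₂ (n : ZMod (k₁ * k₂)) = χ₁ (n : ZMod k₁) * χ₂ (n : ZMod k₂) := by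
  unfold prodChar
  by_cases hcop : n.Coprime (k₁ * k₂)
  · have hZ : IsCoprime (n : ℤ) ((k₁ * k₂ : ℕ) : ℤ) := Nat.isCoprime_iff_coprime.2 hcop
    rw [MulChar.mul_apply, show (n : ZMod (k₁ * k₂)) = ((n : ℤ) : ZMod (k₁ * k₂)) by simp,
      changeLevel_eq_cast_of_dvd' _ _ hZ, changeLevel_eq_cast_of_dvd' _ _ hZ]
    simp
  · have hnu : ¬IsUnit (n : ZMod (k₁ * k₂)) := fun h ↦ hcop ((ZMod.isUnit_iff_coprime n _).1 h)
    rw [MulChar.map_nonunit _ hnu]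
    have : ¬(n.Coprime k₁ ∧ n.Coprime k₂) := fun h ↦ hcop (Nat.Coprime.mul_right h.1 h.2)
    rcases not_and_or.1 this with h | h
    · rw [MulChar.map_nonunit _ (fun hu ↦ h ((ZMod.isUnit_iff_coprime n k₁).1 hu)), zero_mul]
    · rw [MulChar.map_nonunit _ (fun hu ↦ h ((ZMod.isUnit_iff_coprime n k₂).1 hu)), mul_zero]

/-- For distinct primitive real characters, `χ₁χ₂` is not principal. [cite: McCurley1984ZFR, §3] -/
theorem prodChar_ne_one {χ₁ : DirichletCharacter ℂ k₁} {χ₂ : DirichletCharacter ℂ k₂}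
    (hp1 : χ₁.IsPrimitive) (hp2 : χ₂.IsPrimitive) (hq2 : χ₂.IsQuadratic)
    (hdist : k₁ ≠ k₂ ∨ ∃ h : k₁ = k₂, h ▸ χ₁ ≠ χ₂) : prodChar χ₁ χ₂ ≠ 1 := by
  intro h
  have h' : changeLevel (dvd_mul_right k₁ k₂) χ₁ = changeLevel (dvd_mul_left k₂ k₁) χ₂ := by
    have := eq_inv_of_mul_eq_one_left h
    rw [this, ← map_inv, hq2.inv]
  have hcond : k₁ = k₂ := by
    have hc := congrArg DirichletCharacter.conductor h'
    rwa [conductor_changeLevel, conductor_changeLevel, (isPrimitive_def _).1 hp1,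
      (isPrimitive_def _).1 hp2] at hc
  rcases hdist with hne | ⟨heq, hne⟩
  · exact hne hcond
  · subst heq
    exact hne (changeLevel_injective _ h')

/-- `χ₁χ₂` is a real (quadratic) character. [cite: McCurley1984ZFR, §3] -/
theorem prodChar_isQuadratic {χ₁ : DirichletCharacter ℂ k₁} {χ₂ : DirichletCharacter ℂ k₂}
    (hq1 : χ₁.IsQuadratic) (hq2 : χ₂.IsQuadratic) : (prodChar χ₁ χ₂).IsQuadratic := by
  intro a
  have ha : ((a.val : ℕ) : ZMod (k₁ * k₂)) = a := ZMod.natCast_zmod_val a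
  rw [← ha, prodChar_apply_natCast]
  rcases hq1 (a.val : ZMod k₁) with h1 | h1 | h1 <;>
    rcases hq2 (a.val : ZMod k₂) with h2 | h2 | h2 <;>
    · rw [h1, h2]; norm_num

end Product

/-! ### Quadratic characters: values and the primitive character -/

section Quadratic

variable {q : ℕ} [NeZero q] {χ : DirichletCharacter ℂ q}

omit [NeZero q] in
/-- A quadratic character has real values: `Im χ(a) = 0`, `Re χ(a) ∈ {0, 1, −1}`. [folklore] -/
private theorem IsQuadratic.re_cases (hq : χ.IsQuadratic) (a : ZMod q) :
    (χ a).im = 0 ∧ ((χ a).re = 0 ∨ (χ a).re = 1 ∨ (χ a).re = -1) := by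
  rcases hq a with h | h | h <;> simp [h]

omit [NeZero q] in
/-- A quadratic character takes the real value `Re χ(a)`. [folklore] -/
private theorem IsQuadratic.eq_ofReal_re (hq : χ.IsQuadratic) (a : ZMod q) : χ a = ((χ a).re : ℂ) := by
  apply Complex.ext <;> simp [(IsQuadratic.re_cases hq a).1]

/-- The primitive character inducing a quadratic character is quadratic. [folklore] -/
private theorem primitiveCharacter_isQuadratic (hq : χ.IsQuadratic) : χ.primitiveCharacter.IsQuadratic := by
  have hsq : χ.primitiveCharacter ^ 2 = 1 := by
    have h1 : changeLevel χ.conductor_dvd_level (χ.primitiveCharacter ^ 2) = 1 := by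
      rw [map_pow, changeLevel_primitiveCharacter, hq.sq_eq_one]
    exact (changeLevel_eq_one_iff _).1 h1
  intro a
  by_cases ha : IsUnit a
  · have h := congrArg (fun ψ : DirichletCharacter ℂ χ.conductor ↦ ψ a) hsq
    simp only [MulChar.pow_apply' _ two_ne_zero, MulChar.one_apply ha] at h
    rcases sq_eq_one_iff.1 h with h | h
    · exact Or.inr (Or.inl h)
    · exact Or.inr (Or.inr h)
  · exact Or.inl (MulChar.map_nonunit _ ha)

end Quadratic

/-! ### The Euler-factor correction for an induced character -/

/-- The logarithmic derivative of one Euler factor `1 − c p^{−s}` at a real point, real form: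
`e(c, p, t) = c · log p · p^{−t}/(1 − c p^{−t})`. [cite: McCurley1984ZFR, Lemma 9 (proof)] -/
def eulerCorr (c : ℝ) (p : ℕ) (t : ℝ) : ℝ :=
  c * Real.log p * (p : ℝ) ^ (-t) / (1 - c * (p : ℝ) ^ (-t))

/-- `0 < p^{−t} < 1` hence `|c p^{−t}| < 1` for `p ≥ 2`, `t > 0`, `|c| ≤ 1`. [folklore] -/
private theorem rpow_neg_lt_one {p : ℕ} (hp : 2 ≤ p) {t : ℝ} (ht : 0 < t) :
    0 < (p : ℝ) ^ (-t) ∧ (p : ℝ) ^ (-t) < 1 := by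
  have hp1 : (1 : ℝ) < p := by exact_mod_cast hp
  exact ⟨Real.rpow_pos_of_pos (by linarith) _, Real.rpow_lt_one_of_one_lt_of_neg hp1 (by linarith)⟩

/-- **The log-derivative of an Euler factor.** For a prime `p`, a real `t > 0` and `c ∈ {0, 1, −1}`:
`logDeriv (s ↦ 1 − c p^{−s}) (t) = e(c, p, t)`, and the factor does not vanish at `t`.
[cite: McCurley1984ZFR, Lemma 9 (15)] -/
theorem logDeriv_eulerFactor {p : ℕ} (hp : 2 ≤ p) {c : ℝ} (hc : c = 0 ∨ c = 1 ∨ c = -1) {t : ℝ}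
    (ht : 0 < t) :
    (1 - (c : ℂ) * (p : ℂ) ^ (-(t : ℂ)) ≠ 0) ∧
    DifferentiableAt ℂ (fun s : ℂ ↦ 1 - (c : ℂ) * (p : ℂ) ^ (-s)) t ∧
    logDeriv (fun s : ℂ ↦ 1 - (c : ℂ) * (p : ℂ) ^ (-s)) t = (eulerCorr c p t : ℂ) := by
  have hp0 : (p : ℂ) ≠ 0 := by exact_mod_cast (show p ≠ 0 by omega)
  obtain ⟨hu0, hu1⟩ := rpow_neg_lt_one hp ht
  have hpow : (p : ℂ) ^ (-(t : ℂ)) = (((p : ℝ) ^ (-t) : ℝ) : ℂ) := by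
    rw [Complex.ofReal_cpow (Nat.cast_nonneg p), Complex.ofReal_natCast, Complex.ofReal_neg]
  have hc1 : |c| ≤ 1 := by rcases hc with h | h | h <;> simp [h]
  have hne : (1 : ℝ) - c * (p : ℝ) ^ (-t) ≠ 0 := by
    have : |c * (p : ℝ) ^ (-t)| < 1 := by
      rw [abs_mul, abs_of_pos hu0]
      calc |c| * (p : ℝ) ^ (-t) ≤ 1 * (p : ℝ) ^ (-t) := mul_le_mul_of_nonneg_right hc1 hu0.le
        _ < 1 := by linarith
    have h2 : c * (p : ℝ) ^ (-t) < 1 := (abs_lt.1 this).2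
    exact ne_of_gt (by linarith)
  have hneC : (1 : ℂ) - (c : ℂ) * (p : ℂ) ^ (-(t : ℂ)) ≠ 0 := by
    rw [hpow, ← Complex.ofReal_mul, ← Complex.ofReal_one, ← Complex.ofReal_sub]
    exact_mod_cast hne
  -- derivative
  have hd : HasDerivAt (fun s : ℂ ↦ 1 - (c : ℂ) * (p : ℂ) ^ (-s))
      (-((c : ℂ) * ((p : ℂ) ^ (-(t : ℂ)) * Complex.log p * (-1)))) t := by
    have h1 : HasDerivAt (fun s : ℂ ↦ -s) (-1) (t : ℂ) := (hasDerivAt_id (t : ℂ)).neg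
    have h2 := h1.const_cpow (c := (p : ℂ)) (Or.inl hp0)
    exact (h2.const_mul (c : ℂ)).const_sub 1
  refine ⟨hneC, hd.differentiableAt, ?_⟩
  rw [logDeriv_apply, hd.deriv]
  unfold eulerCorr
  rw [hpow, ← Complex.natCast_log]
  push_cast
  ring

/-- **Per-prime bound.** For a prime `p`, `c ∈ {0,1,−1}`, `1 < σ ≤ 1.3`:
`−(e(c,p,σ) − κ e(c,p,σ₁)) ≤ K·(log p if c ≠ 0, else 0)`
(`c = 1`: the difference is `≤ 0`; `c = −1`, `p ≥ 3`: `u/(1+u) ≤ 1/4 < K`; `c = −1`, `p = 2`: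
`u/(1+u) − κ u₁/(1+u₁) ≤ 1/3 − κ/5 < K` using `2^{−σ₁} ≥ 1/4`, i.e. `σ₁ ≤ 2`).
[cite: McCurley1984ZFR, Lemma 9 (proof)] -/
theorem eulerCorr_diff_le {p : ℕ} (hp : p.Prime) {c : ℝ} (hc : c = 0 ∨ c = 1 ∨ c = -1) {σ : ℝ}
    (hσ : 1 < σ) (hσ' : σ ≤ 1.3) :
    -(eulerCorr c p σ - kappa * eulerCorr c p (sigmaOne σ)) ≤
      bigK * (if c = 0 then 0 else Real.log p) := by
  have hp2 : 2 ≤ p := hp.two_le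
  have hp1 : (1 : ℝ) ≤ p := by exact_mod_cast hp.one_le
  have hσ₁ : σ < sigmaOne σ := lt_sigmaOne (by linarith)
  have hσ₁2 : sigmaOne σ < 2 := sigmaOne_lt_two (by linarith) hσ'
  obtain ⟨hu0, hu1⟩ := rpow_neg_lt_one hp2 (show 0 < σ by linarith)
  obtain ⟨hv0, hv1⟩ := rpow_neg_lt_one hp2 (show 0 < sigmaOne σ by linarith)
  have hlogp : 0 ≤ Real.log p := Real.log_nonneg hp1
  have hK := bigK_gt
  have hκ0 := kappa_pos
  have hκ1 := kappa_lt_one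
  -- `u₁ = p^{−σ₁} ≤ u = p^{−σ}`
  have hvu : (p : ℝ) ^ (-sigmaOne σ) ≤ (p : ℝ) ^ (-σ) :=
    Real.rpow_le_rpow_of_exponent_le hp1 (by linarith)
  set u := (p : ℝ) ^ (-σ) with hudef
  set v := (p : ℝ) ^ (-sigmaOne σ) with hvdef
  rcases hc with h | h | h
  · subst h; simp [eulerCorr]
  · subst h
    simp only [eulerCorr, one_mul, if_neg one_ne_zero]
    -- `κ log p · v/(1−v) ≤ log p · u/(1−u)`
    have h1 : v / (1 - v) ≤ u / (1 - u) := by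
      rw [div_le_div_iff₀ (by linarith) (by linarith)]; nlinarith
    have h2 : kappa * (Real.log p * v / (1 - v)) ≤ Real.log p * u / (1 - u) := by
      have hA : 0 ≤ Real.log p * v / (1 - v) := div_nonneg (by positivity) (by linarith)
      calc kappa * (Real.log p * v / (1 - v)) ≤ 1 * (Real.log p * v / (1 - v)) :=
            mul_le_mul_of_nonneg_right hκ1.le hA
        _ = Real.log p * (v / (1 - v)) := by ring
        _ ≤ Real.log p * (u / (1 - u)) := mul_le_mul_of_nonneg_left h1 hlogp
        _ = Real.log p * u / (1 - u) := by ring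
    have : 0 ≤ bigK * Real.log p := by positivity
    linarith
  · subst h
    simp only [eulerCorr, neg_mul, one_mul, sub_neg_eq_add,
      show (-1 : ℝ) ≠ 0 by norm_num, if_false]
    -- goal: -( -(log p * u)/(1+u) - κ * (-(log p * v)/(1+v)) ) ≤ K log p
    have key : u / (1 + u) - kappa * (v / (1 + v)) ≤ bigK := by
      by_cases hp' : p = 2
      · subst hp'
        have hu2 : u < 1 / 2 := by
          rw [hudef, show (1 : ℝ) / 2 = (2 : ℝ) ^ (-(1 : ℝ)) by norm_num]
          push_cast
          exact Real.rpow_lt_rpow_of_exponent_lt (by norm_num) (by linarith)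
        have hv4 : 1 / 4 ≤ v := by
          rw [hvdef, show (1 : ℝ) / 4 = (2 : ℝ) ^ (-(2 : ℝ)) by norm_num]
          push_cast
          exact Real.rpow_le_rpow_of_exponent_le (by norm_num) (by linarith)
        have hA : u / (1 + u) ≤ 1 / 3 := by
          rw [div_le_div_iff₀ (by linarith) (by norm_num)]; linarith
        have hB : 1 / 5 ≤ v / (1 + v) := by
          rw [div_le_div_iff₀ (by norm_num) (by linarith)]; linarith
        have hκ := kappa_gt
        nlinarith
      · have hp3 : 3 ≤ p := by omega
        have hp3' : (3 : ℝ) ≤ p := by exact_mod_cast hp3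
        have hu3 : u ≤ 1 / 3 := by
          rw [hudef]
          calc (p : ℝ) ^ (-σ) ≤ (p : ℝ) ^ (-(1 : ℝ)) :=
                Real.rpow_le_rpow_of_exponent_le hp1 (by linarith)
            _ = 1 / p := by rw [Real.rpow_neg_one]; ring
            _ ≤ 1 / 3 := one_div_le_one_div_of_le (by norm_num) hp3'
        have hA : u / (1 + u) ≤ 1 / 4 := by
          rw [div_le_div_iff₀ (by linarith) (by norm_num)]; linarith
        have hB : 0 ≤ kappa * (v / (1 + v)) := by positivity
        linarith
    have e : -(-(Real.log ↑p * u) / (1 + u) - kappa * (-(Real.log ↑p * v) / (1 + v))) =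
        Real.log p * (u / (1 + u) - kappa * (v / (1 + v))) := by ring
    rw [e]
    calc Real.log p * (u / (1 + u) - kappa * (v / (1 + v))) ≤ Real.log p * bigK :=
          mul_le_mul_of_nonneg_left key hlogp
      _ = bigK * Real.log p := by ring

section Correction

variable {d N : ℕ} [NeZero d] [NeZero N]

/-- **The imprimitivity correction (McCurley's Lemma 9, our constants).** For a quadratic `ψ ≠ 1`
mod `d ∣ N` and `1 < σ ≤ 1.3`: `f_{ψ mod N}(σ) ≤ f_ψ(σ) + K (log N − log d)`
(`L(s, ψ mod N) = L(s, ψ) ∏_{p∣N}(1 − ψ(p)p^{−s})`; per prime the differenced log-derivative is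
`≤ K log p` when `ψ(p) ≠ 0`, i.e. `p ∤ d`, and these primes multiply to a divisor of `N/d`).
[cite: McCurley1984ZFR, Lemma 9] -/
theorem fdiff_changeLevel_le (ψ : DirichletCharacter ℂ d) (hψ1 : ψ ≠ 1) (hq : ψ.IsQuadratic)
    (hd : d ∣ N) {σ : ℝ} (hσ : 1 < σ) (hσ' : σ ≤ 1.3) :
    fdiff (changeLevel hd ψ) σ ≤ fdiff ψ σ + bigK * (Real.log N - Real.log d) := by
  classical
  -- real values of `ψ` at primes
  set c : ℕ → ℝ := fun p ↦ (ψ (p : ZMod d)).re with hcdef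
  have hc : ∀ p : ℕ, c p = 0 ∨ c p = 1 ∨ c p = -1 := fun p ↦ (IsQuadratic.re_cases hq _).2
  have hψc : ∀ p : ℕ, ψ (p : ZMod d) = ((c p : ℝ) : ℂ) := fun p ↦ IsQuadratic.eq_ofReal_re hq _
  -- the Euler product relation and its logarithmic derivative at a real `t > 1`
  have hrel : ∀ {t : ℝ}, 1 < t →
      (-(deriv (changeLevel hd ψ).LFunction t / (changeLevel hd ψ).LFunction t)).re =
        (-(deriv ψ.LFunction t / ψ.LFunction t)).re - ∑ p ∈ N.primeFactors, eulerCorr (c p) p t := by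
    intro t ht
    have ht0 : 0 < t := by linarith
    have hfun : (changeLevel hd ψ).LFunction =
        fun s ↦ ψ.LFunction s * ∏ p ∈ N.primeFactors, (1 - ((c p : ℝ) : ℂ) * (p : ℂ) ^ (-s)) := by
      funext s
      rw [LFunction_changeLevel hd ψ (Or.inl hψ1)]
      congr 1
      exact Finset.prod_congr rfl fun p _ ↦ by rw [hψc p]
    have ht1 : (1 : ℝ) ≤ ((t : ℂ)).re := by simp only [ofReal_re]; exact ht.le
    have hLt : ψ.LFunction t ≠ 0 := LFunction_ne_zero_of_one_le_re ψ (Or.inl hψ1) ht1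
    have hfac : ∀ p ∈ N.primeFactors,
        (1 - ((c p : ℝ) : ℂ) * (p : ℂ) ^ (-(t : ℂ)) ≠ 0) ∧
        DifferentiableAt ℂ (fun s : ℂ ↦ 1 - ((c p : ℝ) : ℂ) * (p : ℂ) ^ (-s)) t ∧
        logDeriv (fun s : ℂ ↦ 1 - ((c p : ℝ) : ℂ) * (p : ℂ) ^ (-s)) t = (eulerCorr (c p) p t : ℂ) :=
      fun p hp ↦ logDeriv_eulerFactor (Nat.prime_of_mem_primeFactors hp).two_le (hc p) ht0
    have hE : (∏ p ∈ N.primeFactors, (1 - ((c p : ℝ) : ℂ) * (p : ℂ) ^ (-(t : ℂ)))) ≠ 0 :=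
      Finset.prod_ne_zero_iff.2 fun p hp ↦ (hfac p hp).1
    have hEd : DifferentiableAt ℂ
        (fun s : ℂ ↦ ∏ p ∈ N.primeFactors, (1 - ((c p : ℝ) : ℂ) * (p : ℂ) ^ (-s))) t :=
      DifferentiableAt.fun_finsetProd fun p hp ↦ (hfac p hp).2.1
    have hLd : DifferentiableAt ℂ ψ.LFunction t :=
      (differentiable_LFunction hψ1).differentiableAt
    have h1 : logDeriv (changeLevel hd ψ).LFunction t =
        logDeriv ψ.LFunction t + ∑ p ∈ N.primeFactors, (eulerCorr (c p) p t : ℂ) := by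
      rw [hfun, logDeriv_mul (t : ℂ) hLt hE hLd hEd,
        logDeriv_prod (fun p hp ↦ (hfac p hp).1) (fun p hp ↦ (hfac p hp).2.1)]
      congr 1
      exact Finset.sum_congr rfl fun p hp ↦ (hfac p hp).2.2
    have h2 := congrArg Complex.re h1
    rw [logDeriv_apply, logDeriv_apply, add_re, Complex.re_sum] at h2
    simp only [Complex.ofReal_re] at h2
    rw [neg_re, neg_re, h2]
    ring
  have hσ₁ : 1 < sigmaOne σ := one_lt_sigmaOne hσ.le
  unfold fdiff
  rw [hrel hσ, hrel hσ₁]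
  -- the prime sum
  have hsum : -(∑ p ∈ N.primeFactors, eulerCorr (c p) p σ) +
      kappa * ∑ p ∈ N.primeFactors, eulerCorr (c p) p (sigmaOne σ) ≤
        bigK * (Real.log N - Real.log d) := by
    rw [Finset.mul_sum, ← Finset.sum_neg_distrib, ← Finset.sum_add_distrib]
    have hstep : ∑ p ∈ N.primeFactors, (-eulerCorr (c p) p σ + kappa * eulerCorr (c p) p (sigmaOne σ))
        ≤ ∑ p ∈ N.primeFactors, bigK * (if c p ≠ 0 then Real.log p else 0) := by
      refine Finset.sum_le_sum fun p hp ↦ ?_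
      have h := eulerCorr_diff_le (Nat.prime_of_mem_primeFactors hp) (hc p) hσ hσ'
      have e : (if c p = 0 then (0 : ℝ) else Real.log p) = (if c p ≠ 0 then Real.log p else 0) := by
        by_cases h0 : c p = 0 <;> simp [h0]
      rw [e] at h
      linarith
    refine hstep.trans ?_
    rw [← Finset.mul_sum, ← Finset.sum_filter]
    refine mul_le_mul_of_nonneg_left ?_ bigK_pos.le
    -- the primes `p ∣ N` with `ψ(p) ≠ 0` do not divide `d`; their product divides `N/d`
    set S := N.primeFactors.filter (fun p ↦ c p ≠ 0) with hSdef
    have hSprime : ∀ p ∈ S, p.Prime := fun p hp ↦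
      Nat.prime_of_mem_primeFactors (Finset.mem_filter.1 hp).1
    have hSdvd : ∀ p ∈ S, p ∣ N / d := by
      intro p hp
      obtain ⟨hpN, hcp⟩ := Finset.mem_filter.1 hp
      have hpP := Nat.prime_of_mem_primeFactors hpN
      have hpdN : p ∣ N := Nat.dvd_of_mem_primeFactors hpN
      have hnd : ¬ p ∣ d := by
        intro hpd
        apply hcp
        have hnu : ¬IsUnit ((p : ZMod d)) := fun hu ↦ ((ZMod.isUnit_prime_iff_not_dvd hpP).1 hu) hpd
        simp [hcdef, MulChar.map_nonunit _ hnu]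
      have hN : N = d * (N / d) := (Nat.mul_div_cancel' hd).symm
      rw [hN] at hpdN
      exact ((Nat.Prime.dvd_mul hpP).1 hpdN).resolve_left hnd
    have hprod : ∏ p ∈ S, p ∣ N / d :=
      Finset.prod_primes_dvd (N / d) (fun p hp ↦ Nat.prime_iff.1 (hSprime p hp)) hSdvd
    have hNd : 0 < N / d := Nat.div_pos (Nat.le_of_dvd (Nat.pos_of_ne_zero (NeZero.ne N)) hd)
      (Nat.pos_of_ne_zero (NeZero.ne d))
    have hle : (∏ p ∈ S, (p : ℝ)) ≤ (N : ℝ) / d := by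
      have h := Nat.le_of_dvd hNd hprod
      have h' : ((∏ p ∈ S, p : ℕ) : ℝ) ≤ ((N / d : ℕ) : ℝ) := by exact_mod_cast h
      rw [Nat.cast_prod, Nat.cast_div hd (by exact_mod_cast NeZero.ne d)] at h'
      exact h'
    have hpos : 0 < ∏ p ∈ S, (p : ℝ) :=
      Finset.prod_pos fun p hp ↦ by exact_mod_cast (hSprime p hp).pos
    calc ∑ p ∈ S, Real.log p = Real.log (∏ p ∈ S, (p : ℝ)) := by
          rw [Real.log_prod fun p hp ↦ by exact_mod_cast (hSprime p hp).ne_zero]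
      _ ≤ Real.log ((N : ℝ) / d) := Real.log_le_log hpos hle
      _ = Real.log N - Real.log d := by
          rw [Real.log_div (by exact_mod_cast NeZero.ne N) (by exact_mod_cast NeZero.ne d)]
  linarith

end Correction

end McCurleyStechkin

/-! ## Positivity (McCurley's (23)), the assembled inequality (25), and Theorem 2 -/

namespace McCurleyStechkin

open DirichletCharacter ArithmeticFunction

/-- The Gamma-factor term is `≤ −0.44` for either parity (`1 < σ ≤ 1.3`).
[cite: McCurley1984ZFR, Lemma 8] -/
theorem gammaTerm_le {q : ℕ} [NeZero q] (χ : DirichletCharacter ℂ q) {σ : ℝ} (hσ : 1 < σ)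
    (hσ' : σ ≤ 1.3) :
    (logDeriv Gammaℝ ((σ : ℂ) + charParity χ)).re
      - kappa * (logDeriv Gammaℝ ((sigmaOne σ : ℂ) + charParity χ)).re ≤ -0.44 := by
  rcases Nat.le_one_iff_eq_zero_or_eq_one.1 (charParity_le_one χ) with h | h
  · rw [h]
    simp only [Nat.cast_zero, add_zero]
    have := gammaTerm_even_le hσ hσ'
    linarith
  · rw [h]
    simp only [Nat.cast_one]
    exact gammaTerm_odd_le hσ hσ'

/-- `κ(2σ₁ − 1) ≤ σ` for `σ ≥ 1` (`⇔ 1 + 4σ² ≤ 5σ²`). [cite: McCurley1984ZFR, §3 (26)] -/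
theorem kappa_mul_le_self {σ : ℝ} (hσ : 1 ≤ σ) : kappa * (2 * sigmaOne σ - 1) ≤ σ := by
  rw [two_mul_sigmaOne_sub_one]
  have hk := kappa_pos
  have hle : Real.sqrt (1 + 4 * σ ^ 2) ≤ Real.sqrt 5 * σ := by
    rw [show Real.sqrt 5 * σ = Real.sqrt (5 * σ ^ 2) by
      rw [Real.sqrt_mul (by norm_num), Real.sqrt_sq (by linarith)]]
    exact Real.sqrt_le_sqrt (by nlinarith)
  calc kappa * Real.sqrt (1 + 4 * σ ^ 2) ≤ kappa * (Real.sqrt 5 * σ) :=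
        mul_le_mul_of_nonneg_left hle hk.le
    _ = σ := by rw [← mul_assoc, kappa_mul_sqrt5, one_mul]

/-- **The kept pair dominates `1/(σ−β)`**: for `σ ≥ 1` and `0 < β ≤ 1`,
`1/(σ−β) ≤ P(σ,β) = [1/(σ−β) + 1/(σ−1+β)] − κ[1/(σ₁−β) + 1/(σ₁−1+β)]`
(the Stechkin corrections are absorbed by the partner zero: `κ/(σ₁−β) ≤ κ/(σ₁−1)`,
`κ/(σ₁−1+β) − κ/σ₁ ≤ 1/(σ−1+β) − 1/σ`, and `κ/(σ₁−1) + κ/σ₁ ≤ 1/σ`, with equality at `σ = 1`).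
[cite: McCurley1984ZFR, §3 (25)–(26)] -/
theorem inv_sub_le_stechkinPair {σ β : ℝ} (hσ : 1 ≤ σ) (hβ0 : 0 < β) (hβ1 : β ≤ 1) :
    1 / (σ - β) ≤ (1 / (σ - β) + 1 / (σ - 1 + β)) -
        kappa * (1 / (sigmaOne σ - β) + 1 / (sigmaOne σ - 1 + β)) := by
  have hσ₁ := one_lt_sigmaOne hσ
  have hσσ₁ := lt_sigmaOne (show (0 : ℝ) < σ by linarith)
  have hk0 := kappa_pos
  have hk1 := kappa_lt_one
  have hsq := sigmaOne_sq σ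
  have hkσ := kappa_mul_le_self hσ
  have hσ1β : 0 < σ - 1 + β := by linarith
  have hσ₁1β : 0 < sigmaOne σ - 1 + β := by linarith
  -- (i)
  have h1 : kappa * (1 / (sigmaOne σ - β)) ≤ kappa * (1 / (sigmaOne σ - 1)) :=
    mul_le_mul_of_nonneg_left (one_div_le_one_div_of_le (by linarith) (by linarith)) hk0.le
  -- (ii)
  have h2 : kappa * (1 / (sigmaOne σ - 1 + β)) - kappa * (1 / sigmaOne σ) ≤
      1 / (σ - 1 + β) - 1 / σ := by
    have eL : kappa * (1 / (sigmaOne σ - 1 + β)) - kappa * (1 / sigmaOne σ) =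
        kappa * ((1 - β) / (sigmaOne σ * (sigmaOne σ - 1 + β))) := by
      field_simp
      ring
    have eR : 1 / (σ - 1 + β) - 1 / σ = (1 - β) / (σ * (σ - 1 + β)) := by
      field_simp
      ring
    rw [eL, eR]
    have hden : σ * (σ - 1 + β) ≤ sigmaOne σ * (sigmaOne σ - 1 + β) := by nlinarith
    have hpos : 0 < σ * (σ - 1 + β) := by positivity
    calc kappa * ((1 - β) / (sigmaOne σ * (sigmaOne σ - 1 + β)))
        ≤ 1 * ((1 - β) / (sigmaOne σ * (sigmaOne σ - 1 + β))) :=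
          mul_le_mul_of_nonneg_right hk1.le (div_nonneg (by linarith) (by positivity))
      _ = (1 - β) / (sigmaOne σ * (sigmaOne σ - 1 + β)) := one_mul _
      _ ≤ (1 - β) / (σ * (σ - 1 + β)) := div_le_div_of_nonneg_left (by linarith) hpos hden
  -- (iii)
  have h3 : kappa * (1 / (sigmaOne σ - 1)) + kappa * (1 / sigmaOne σ) ≤ 1 / σ := by
    have hne1 : sigmaOne σ - 1 ≠ 0 := by linarith
    have hne2 : sigmaOne σ ≠ 0 := by linarith
    have e : kappa * (1 / (sigmaOne σ - 1)) + kappa * (1 / sigmaOne σ) =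
        kappa * (2 * sigmaOne σ - 1) / (sigmaOne σ * (sigmaOne σ - 1)) := by
      field_simp
      ring
    rw [e, show sigmaOne σ * (sigmaOne σ - 1) = σ ^ 2 by nlinarith [hsq],
      div_le_div_iff₀ (by positivity) (by linarith)]
    nlinarith [hkσ]
  rw [mul_add]
  linarith [h1, h2, h3]

/-- **McCurley's (23): positivity.** For quadratic `χ₁, χ₂` and real `σ > 1`:
`0 ≤ f_ζ(σ) + f_{χ₁}(σ) + f_{χ₂}(σ) + f_{χ₁χ₂}(σ)`, because the combined Dirichlet series is
`Σ_n Λ(n)(n^{−σ} − κ n^{−σ₁})(1 + χ₁(n))(1 + χ₂(n))` with non-negative terms.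
[cite: McCurley1984ZFR, §3 (23)] -/
theorem positivity_sum {k₁ k₂ : ℕ} [NeZero k₁] [NeZero k₂] {χ₁ : DirichletCharacter ℂ k₁}
    {χ₂ : DirichletCharacter ℂ k₂} (hq1 : χ₁.IsQuadratic) (hq2 : χ₂.IsQuadratic) {σ : ℝ}
    (hσ : 1 < σ) :
    0 ≤ fdiffZeta σ + fdiff χ₁ σ + fdiff χ₂ σ + fdiff (prodChar χ₁ χ₂) σ := by
  have hσ₁ : 1 < sigmaOne σ := one_lt_sigmaOne hσ.le
  have hσσ₁ : σ ≤ sigmaOne σ := (lt_sigmaOne (show (0 : ℝ) < σ by linarith)).le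
  have Z0 := hasSum_vonMangoldt_zeta hσ
  have Z1 := hasSum_vonMangoldt_zeta hσ₁
  have A0 := hasSum_re_twist χ₁ hσ
  have A1 := hasSum_re_twist χ₁ hσ₁
  have B0 := hasSum_re_twist χ₂ hσ
  have B1 := hasSum_re_twist χ₂ hσ₁
  have C0 := hasSum_re_twist (prodChar χ₁ χ₂) hσ
  have C1 := hasSum_re_twist (prodChar χ₁ χ₂) hσ₁
  have hS := ((Z0.sub (Z1.mul_left kappa)).add (A0.sub (A1.mul_left kappa))).add
    ((B0.sub (B1.mul_left kappa)).add (C0.sub (C1.mul_left kappa)))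
  have hval : fdiffZeta σ + fdiff χ₁ σ + fdiff χ₂ σ + fdiff (prodChar χ₁ χ₂) σ =
      (-(deriv riemannZeta σ / riemannZeta σ)).re -
          kappa * (-(deriv riemannZeta (sigmaOne σ) / riemannZeta (sigmaOne σ))).re +
        ((-(deriv χ₁.LFunction σ / χ₁.LFunction σ)).re -
          kappa * (-(deriv χ₁.LFunction (sigmaOne σ) / χ₁.LFunction (sigmaOne σ))).re) +
      ((-(deriv χ₂.LFunction σ / χ₂.LFunction σ)).re -
          kappa * (-(deriv χ₂.LFunction (sigmaOne σ) / χ₂.LFunction (sigmaOne σ))).re +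
        ((-(deriv (prodChar χ₁ χ₂).LFunction σ / (prodChar χ₁ χ₂).LFunction σ)).re -
          kappa * (-(deriv (prodChar χ₁ χ₂).LFunction (sigmaOne σ) /
            (prodChar χ₁ χ₂).LFunction (sigmaOne σ))).re)) := by
    unfold fdiffZeta fdiff
    ring
  rw [hval]
  refine hS.nonneg fun n ↦ ?_
  -- the `n`-th term, factored
  have hx₁ := IsQuadratic.re_cases hq1 (n : ZMod k₁)
  have hx₂ := IsQuadratic.re_cases hq2 (n : ZMod k₂)
  have hprod : ((prodChar χ₁ χ₂) (n : ZMod (k₁ * k₂))).re =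
      (χ₁ (n : ZMod k₁)).re * (χ₂ (n : ZMod k₂)).re := by
    rw [prodChar_apply_natCast, Complex.mul_re, hx₁.1, hx₂.1]
    ring
  set x₁ := (χ₁ (n : ZMod k₁)).re with hx₁def
  set x₂ := (χ₂ (n : ZMod k₂)).re with hx₂def
  set a := (Λ n : ℝ) with hadef
  set u := (n : ℝ) ^ σ with hudef
  set v := (n : ℝ) ^ sigmaOne σ with hvdef
  rw [hprod]
  have ha : 0 ≤ a := vonMangoldt_nonneg
  have hw : 0 ≤ 1 / u - kappa * (1 / v) := by
    rcases Nat.eq_zero_or_pos n with hn | hn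
    · have hu0 : u = 0 := by rw [hudef, hn, Nat.cast_zero, Real.zero_rpow (by linarith)]
      have hv0 : v = 0 := by rw [hvdef, hn, Nat.cast_zero, Real.zero_rpow (by linarith)]
      simp [hu0, hv0]
    · have hn1 : (1 : ℝ) ≤ n := by exact_mod_cast hn
      have hupos : 0 < u := Real.rpow_pos_of_pos (by linarith) _
      have huv : u ≤ v := Real.rpow_le_rpow_of_exponent_le hn1 hσσ₁
      have h1 : 1 / v ≤ 1 / u := one_div_le_one_div_of_le hupos huv
      have h2 : 0 ≤ 1 / v := by positivity
      nlinarith [kappa_lt_one, kappa_pos]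
  have hx : 0 ≤ (1 + x₁) * (1 + x₂) := by
    refine mul_nonneg ?_ ?_
    · rcases hx₁.2 with h | h | h <;> rw [h] <;> norm_num
    · rcases hx₂.2 with h | h | h <;> rw [h] <;> norm_num
  have key : 0 ≤ a * (1 / u - kappa * (1 / v)) * ((1 + x₁) * (1 + x₂)) :=
    mul_nonneg (mul_nonneg ha hw) hx
  have e : a * (1 / u - kappa * (1 / v)) * ((1 + x₁) * (1 + x₂)) =
      a / u - kappa * (a / v) + (a * x₁ / u - kappa * (a * x₁ / v)) +
        (a * x₂ / u - kappa * (a * x₂ / v) + (a * (x₁ * x₂) / u - kappa * (a * (x₁ * x₂) / v))) := by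
    ring
  linarith [key, e]

/-- **McCurley's (25) with the constants proved here.** Let `χ₁ mod k₁`, `χ₂ mod k₂` be distinct
primitive quadratic characters, both `≠ 1`, with real zeros `β₁, β₂ ∈ (0,1]∖{½}`, and let
`1 < σ ≤ 1.3`. Then
`1/(σ−β₁) + 1/(σ−β₂) − 1/(σ−1) ≤ 2K log(k₁k₂) − 1.645`
(positivity (23); `f_ζ ≤ 1/(σ−1) − 0.325`; `f_{χ_i} ≤ K log k_i − 0.44 − P(σ,β_i)`, `P ≥ 1/(σ−β_i)`;
`f_{χ₁χ₂} ≤ K log(k₁k₂) − 0.44` through the primitive character inducing `χ₁χ₂`). McCurley prints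
`2K log k₁k₂ − 1.59`; any constant `> 2K log 17 = 1.566…` serves. [cite: McCurley1984ZFR, §3 (25)] -/
theorem main_inequality {k₁ k₂ : ℕ} [NeZero k₁] [NeZero k₂]
    {χ₁ : DirichletCharacter ℂ k₁} {χ₂ : DirichletCharacter ℂ k₂}
    (hp1 : χ₁.IsPrimitive) (hq1 : χ₁.IsQuadratic) (hp2 : χ₂.IsPrimitive) (hq2 : χ₂.IsQuadratic)
    (hdist : k₁ ≠ k₂ ∨ ∃ h : k₁ = k₂, h ▸ χ₁ ≠ χ₂) (h11 : χ₁ ≠ 1) (h21 : χ₂ ≠ 1)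
    {β₁ β₂ : ℝ} (hb1 : 0 < β₁) (hb1h : β₁ ≠ 1 / 2) (hb1u : β₁ ≤ 1) (hz1 : χ₁.LFunction β₁ = 0)
    (hb2 : 0 < β₂) (hb2h : β₂ ≠ 1 / 2) (hb2u : β₂ ≤ 1) (hz2 : χ₂.LFunction β₂ = 0)
    {σ : ℝ} (hσ : 1 < σ) (hσ' : σ ≤ 1.3) :
    1 / (σ - β₁) + 1 / (σ - β₂) - 1 / (σ - 1) ≤
      2 * bigK * Real.log ((k₁ : ℝ) * k₂) - 1.645 := by
  set ψt := prodChar χ₁ χ₂ with hψt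
  have hψt1 : ψt ≠ 1 := prodChar_ne_one hp1 hp2 hq2 hdist
  have hψtq : ψt.IsQuadratic := prodChar_isQuadratic hq1 hq2
  haveI : NeZero ψt.conductor := ⟨conductor_ne_zero ψt⟩
  set ψ := ψt.primitiveCharacter with hψ
  have hind : changeLevel ψt.conductor_dvd_level ψ = ψt := changeLevel_primitiveCharacter ψt
  have hψ1 : ψ ≠ 1 := by
    intro h
    apply hψt1
    rw [← hind, h]
    exact changeLevel_one _
  have hψp : ψ.IsPrimitive := primitiveCharacter_isPrimitive ψt
  have hψq : ψ.IsQuadratic := primitiveCharacter_isQuadratic hψtq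
  have hZ := zetaTerm_le hσ hσ'
  have hC1 := DirichletTheta.stechkinDiff_logDeriv_le_of_realZero hp1 h11 hb1 hb1h hz1 hσ
  have hC2 := DirichletTheta.stechkinDiff_logDeriv_le_of_realZero hp2 h21 hb2 hb2h hz2 hσ
  have hCψ := DirichletTheta.stechkinDiff_logDeriv_le hψp hψ1 hσ
  rw [← fdiff_eq_logDeriv] at hC1 hC2 hCψ
  have hG1 := gammaTerm_le χ₁ hσ hσ'
  have hG2 := gammaTerm_le χ₂ hσ hσ'
  have hGψ := gammaTerm_le ψ hσ hσ'
  have hP1 := inv_sub_le_stechkinPair hσ.le hb1 hb1u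
  have hP2 := inv_sub_le_stechkinPair hσ.le hb2 hb2u
  have hcorr : fdiff ψt σ ≤ fdiff ψ σ +
      bigK * (Real.log ((k₁ * k₂ : ℕ) : ℝ) - Real.log (ψt.conductor : ℝ)) := by
    have h := fdiff_changeLevel_le ψ hψ1 hψq ψt.conductor_dvd_level hσ hσ'
    rwa [hind] at h
  have hpos := positivity_sum hq1 hq2 hσ
  have hk₁ : (0 : ℝ) < k₁ := by exact_mod_cast Nat.pos_of_ne_zero (NeZero.ne k₁)
  have hk₂ : (0 : ℝ) < k₂ := by exact_mod_cast Nat.pos_of_ne_zero (NeZero.ne k₂)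
  have hlogN : Real.log ((k₁ * k₂ : ℕ) : ℝ) = Real.log k₁ + Real.log k₂ := by
    push_cast
    exact Real.log_mul hk₁.ne' hk₂.ne'
  have hlogN' : Real.log ((k₁ : ℝ) * k₂) = Real.log k₁ + Real.log k₂ := Real.log_mul hk₁.ne' hk₂.ne'
  rw [hlogN] at hcorr
  rw [hlogN']
  unfold fdiffZeta at hpos
  linarith

/-! ### McCurley's (26): the choice `σ = 1 + r/log M₁` and the conclusion -/

/-- `1.41421 < √2`. [folklore] -/
private theorem sqrt2_gt : (1.41421 : ℝ) < Real.sqrt 2 := by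
  rw [show (1.41421 : ℝ) = Real.sqrt (1.41421 ^ 2) by rw [Real.sqrt_sq (by norm_num)]]
  exact Real.sqrt_lt_sqrt (by norm_num) (by norm_num)

/-- `√2 < 1.41422`. [folklore] -/
private theorem sqrt2_lt : Real.sqrt 2 < 1.41422 := by
  rw [show (1.41422 : ℝ) = Real.sqrt (1.41422 ^ 2) by rw [Real.sqrt_sq (by norm_num)]]
  exact Real.sqrt_lt_sqrt (by norm_num) (by norm_num)

/-- `landauConst = 1/R₁ < 0.311`. [cite: McCurley1984ZFR, Theorem 2] -/
theorem landauConst_lt : ThornerZaman2024.landauConst < 0.311 := by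
  unfold ThornerZaman2024.landauConst
  have h2 := sqrt2_gt
  have h5 := sqrt5_lt
  rw [div_lt_iff₀ (by linarith)]
  nlinarith

/-- **The optimisation identity behind `R₁`**: with `r = (√2 − 1)/(2K)`,
`2/(r + 1/R₁) − 1/r = 2K` exactly (`1/R₁ = (3 − 2√2)/(2K)`, `r + 1/R₁ = (2 − √2)/(2K)`).
[cite: McCurley1984ZFR, §3 (26)] -/
theorem key_identity :
    2 / ((Real.sqrt 2 - 1) / (2 * bigK) + ThornerZaman2024.landauConst) -
        1 / ((Real.sqrt 2 - 1) / (2 * bigK)) = 2 * bigK := by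
  set t := Real.sqrt 2 with ht
  set s := Real.sqrt 5 with hs
  have h2 : t ^ 2 = 2 := Real.sq_sqrt (by norm_num)
  have h5 : s ^ 2 = 5 := sq_sqrt5
  have ht1 : 1.41421 < t := sqrt2_gt
  have ht2 : t < 1.41422 := sqrt2_lt
  have hs1 : 2.236 < s := sqrt5_gt
  have hsne : s ≠ 0 := by linarith
  have hs1ne : s - 1 ≠ 0 := by linarith
  have ht1ne : t - 1 ≠ 0 := by linarith
  have ht2ne : 2 - t ≠ 0 := by linarith
  have h5sne : 5 - s ≠ 0 := by nlinarith
  have eK : 2 * bigK = (s - 1) / s := by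
    unfold bigK kappa
    rw [← hs]
    field_simp
  have ec : ThornerZaman2024.landauConst = s * (3 - 2 * t) / (s - 1) := by
    unfold ThornerZaman2024.landauConst
    rw [← ht, ← hs, div_eq_div_iff h5sne hs1ne]
    linear_combination (3 - 2 * t) * h5
  rw [eK, ec]
  have hsum : (t - 1) / ((s - 1) / s) + s * (3 - 2 * t) / (s - 1) = s * (2 - t) / (s - 1) := by
    field_simp
    ring
  rw [hsum]
  have e : 2 / (s * (2 - t) / (s - 1)) - 1 / ((t - 1) / ((s - 1) / s)) - (s - 1) / s =
      (s - 1) / s * ((t ^ 2 - 2) / ((2 - t) * (t - 1))) := by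
    field_simp
    ring
  have hz : (s - 1) / s * ((t ^ 2 - 2) / ((2 - t) * (t - 1))) = 0 := by
    rw [h2, sub_self, zero_div, mul_zero]
  linarith [e, hz]

/-- A primitive character with a real zero in `(0, ∞)` is non-principal, and the zero is `< 1`
(for `χ = 1` the level is `1` and `L(s, 1) = ζ(s)` has no real zeros in `(0,1)` or `[1, ∞)`).
[cite: MontgomeryVaughan2007, Cor 10.8] -/
theorem ne_one_and_lt_one {k : ℕ} [NeZero k] {χ : DirichletCharacter ℂ k} (hp : χ.IsPrimitive)
    {β : ℝ} (hβ : 0 < β) (hz : χ.LFunction β = 0) : χ ≠ 1 ∧ β < 1 := by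
  by_cases h1 : χ = 1
  · exfalso
    have hc : χ.conductor = 1 := by rw [h1, conductor_one]
    have hk : k = 1 := (((isPrimitive_def χ).1 hp).symm.trans hc)
    subst hk
    rw [LFunction_modOne_eq] at hz
    rcases lt_or_ge β 1 with hb | hb
    · exact riemannZeta_ne_zero_of_mem_Ioo_holds β hβ hb hz
    · exact riemannZeta_ne_zero_of_one_le_re (by simpa using hb) hz
  · refine ⟨h1, ?_⟩
    by_contra hb
    exact LFunction_ne_zero_of_one_le_re χ (Or.inl h1) (by simpa using not_lt.1 hb) hz

end McCurleyStechkin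

open McCurleyStechkin in
/-- **McCurley 1984, Theorem 2 — DISCHARGED.** For distinct real primitive characters `χ₁ mod k₁`,
`χ₂ mod k₂` and real zeros `β_i` of `L(s, χ_i)`: `min{β₁, β₂} < 1 − 1/(R₁ log M₁)` with
`R₁ = (5 − √5)/(15 − 10√2)`, `M₁ = max{k₁k₂/17, 13}`. Proof (McCurley §3 with Stechkin's device,
constants re-derived in the kernel): if both `β_i ≥ 1 − c/L` (`c = 1/R₁`, `L = log M₁ ≥ log 13`),
take `σ = 1 + r/L`, `r = (√2 − 1)/(2K)`; then `main_inequality` gives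
`1/(σ−β₁) + 1/(σ−β₂) − 1/(σ−1) ≤ 2K log(k₁k₂) − 1.645 < 2K(L + log 17) − 1.645 < 2KL`, while
`1/(σ−β_i) ≥ L/(r+c)` and `2/(r+c) − 1/r = 2K` give the reverse inequality `≥ 2KL`.
[cite: McCurley1984ZFR, Theorem 2, §3 (23)–(26)] -/
theorem McCurley1984_theorem2_holds : McCurley1984_theorem2 := by
  intro k₁ k₂ _ _ χ₁ χ₂ hp1 hq1 hp2 hq2 hdist β₁ β₂ hz1 hz2
  rw [ThornerZaman2024.one_div_rOne_mul_eq]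
  set M : ℝ := max ((k₁ : ℝ) * k₂ / 17) 13 with hMdef
  have hM13 : (13 : ℝ) ≤ M := le_max_right _ _
  set L : ℝ := Real.log M with hLdef
  have hL25 : 2.5 ≤ L := log_thirteen_ge.trans (Real.log_le_log (by norm_num) hM13)
  have hLpos : 0 < L := by linarith
  set c : ℝ := ThornerZaman2024.landauConst with hcdef
  have hc0 : 0 < c := by
    have := ThornerZaman2024.pageConst_pos
    rw [ThornerZaman2024.pageConst_eq_half_landauConst] at this
    linarith
  have hc1 : c < 0.311 := landauConst_lt
  by_contra hcon
  obtain ⟨hb1, hb2⟩ := le_min_iff.1 (not_lt.1 hcon)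
  have hcL : c / L ≤ 0.1244 := by
    rw [div_le_iff₀ hLpos]
    linarith
  have hβ1 : 0.8756 ≤ β₁ := by linarith
  have hβ2 : 0.8756 ≤ β₂ := by linarith
  obtain ⟨h11, hβ1lt⟩ := ne_one_and_lt_one hp1 (by linarith) hz1
  obtain ⟨h21, hβ2lt⟩ := ne_one_and_lt_one hp2 (by linarith) hz2
  -- the abscissa `σ = 1 + r/L`
  set r : ℝ := (Real.sqrt 2 - 1) / (2 * bigK) with hrdef
  have hK := bigK_gt
  have hK' := bigK_lt
  have h2a := sqrt2_gt
  have h2b := sqrt2_lt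
  have hr0 : 0 < r := div_pos (by linarith) (by linarith)
  have hr1 : r ≤ 0.7495 := by
    rw [hrdef, div_le_iff₀ (by linarith)]
    linarith
  set σ : ℝ := 1 + r / L with hσdef
  have hrL : 0 < r / L := div_pos hr0 hLpos
  have hσ1 : 1 < σ := by linarith
  have hσ13 : σ ≤ 1.3 := by
    have : r / L ≤ 0.7495 / 2.5 := by
      rw [div_le_div_iff₀ hLpos (by norm_num)]
      linarith
    linarith
  have hmain := main_inequality hp1 hq1 hp2 hq2 hdist h11 h21 (by linarith) (by linarith)
    hβ1lt.le hz1 (by linarith) (by linarith) hβ2lt.le hz2 hσ1 hσ13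
  -- `log(k₁k₂) ≤ log 17 + L`
  have hk₁ : (0 : ℝ) < k₁ := by exact_mod_cast Nat.pos_of_ne_zero (NeZero.ne k₁)
  have hk₂ : (0 : ℝ) < k₂ := by exact_mod_cast Nat.pos_of_ne_zero (NeZero.ne k₂)
  have hlogN : Real.log ((k₁ : ℝ) * k₂) ≤ Real.log 17 + L := by
    have h17 : (k₁ : ℝ) * k₂ / 17 ≤ M := le_max_left _ _
    have h := Real.log_le_log (by positivity) h17
    rw [Real.log_div (by positivity) (by norm_num)] at h
    linarith
  have h17 := log_seventeen_le
  -- upper bound `< 2KL`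
  have hS_lt : 1 / (σ - β₁) + 1 / (σ - β₂) - 1 / (σ - 1) < 2 * bigK * L := by
    have h2K : 2 * bigK * Real.log ((k₁ : ℝ) * k₂) ≤ 2 * bigK * (Real.log 17 + L) :=
      mul_le_mul_of_nonneg_left hlogN (by linarith)
    have hl17 : 0 ≤ Real.log 17 := Real.log_nonneg (by norm_num)
    have hprod : 2 * bigK * Real.log 17 ≤ 2 * 0.276395 * 2.84 :=
      mul_le_mul (by linarith) h17 hl17 (by norm_num)
    linarith
  -- lower bound `≥ 2KL`
  have hS_ge : 2 * bigK * L ≤ 1 / (σ - β₁) + 1 / (σ - β₂) - 1 / (σ - 1) := by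
    have hkey : 2 / (r + c) - 1 / r = 2 * bigK := key_identity
    have hrc : 0 < r + c := by linarith
    have hσβ₁ : 0 < σ - β₁ := by linarith
    have hσβ₂ : 0 < σ - β₂ := by linarith
    have hd₁ : σ - β₁ ≤ (r + c) / L := by
      rw [hσdef, add_div]; linarith
    have hd₂ : σ - β₂ ≤ (r + c) / L := by
      rw [hσdef, add_div]; linarith
    have h1 : L / (r + c) ≤ 1 / (σ - β₁) := by
      rw [div_le_div_iff₀ hrc hσβ₁, one_mul]
      have := (le_div_iff₀ hLpos).1 hd₁
      linarith
    have h2 : L / (r + c) ≤ 1 / (σ - β₂) := by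
      rw [div_le_div_iff₀ hrc hσβ₂, one_mul]
      have := (le_div_iff₀ hLpos).1 hd₂
      linarith
    have h3 : 1 / (σ - 1) = L / r := by
      rw [hσdef, add_sub_cancel_left, one_div_div]
    have e : 2 * (L / (r + c)) - L / r = L * (2 / (r + c) - 1 / r) := by ring
    have e2 : 2 * bigK * L = 2 * (L / (r + c)) - L / r := by rw [e, hkey]; ring
    rw [h3]
    linarith [h1, h2, e2]
  linarith

/-- **Thorner–Zaman 2024, Lemma 2.4 — the named fact `thornerZaman2024_lemma24` DISCHARGED.**
"Let `χ (mod q)` and `χ' (mod q')` be distinct real primitive characters with `min{q,q'} > 400 000`.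
If `β` (resp. `β'`) is a real zero of `L(s,χ)` (resp. `L(s,χ')`), then
`min{β,β'} < 1 − (15 − 10√2)/((5 − √5) log(q'q/17))`." Proof: McCurley's Theorem 2
(`McCurley1984_theorem2_holds`, above) through the tree's derivation
`thornerZaman2024_lemma24_of_mccurley2` (`ExplicitLandauPageFamily.lean`: for `min{q,q'} > 400 000`
one has `q'q/17 > 13`, so `M₁ = q'q/17`, and `1/R₁ = landauConst`). Users of
`(h24 : thornerZaman2024_lemma24)` (`ExplicitLandauPageFamilyProofs.lean`,
`SingleCharacterPageExplicit.lean`, `DirichletRealZeroHoffsteinWindow.lean`) are fed this theorem.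
[cite: ThornerZaman2024LogFree, Lemma 2.4] [cite: McCurley1984ZFR, Theorem 2] -/
theorem thornerZaman2024_lemma24_holds : thornerZaman2024_lemma24 :=
  thornerZaman2024_lemma24_of_mccurley2 McCurley1984_theorem2_holds

end Literature.NumberTheory.LFunctions

end
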